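import Literature.Analysis.FunctionSpaces.KontorovichLebedevInversion
import HarnessLib

/-!
# The Kuznetsov transforms as entire functions of the spectral parameter (Iwaniec, GSM 53, (1.63))

Topic `Analysis/FunctionSpaces` (namespace `Literature.Analysis.FunctionSpaces`), continuing
`KontorovichLebedevInversion.lean` (smooth test functions `IsSmoothPosTest`, the cosine transform `P_ρ` and its
derivatives `PcDeriv`). For the transforms of `Literature.NumberTheory.Sieve.BombieriFriedlanderIwaniecKuznetsovTransforms`
(`kuzTransforms.Tpl/Tmi φ t`, `TplX/TmiX φ y`, defined for REAL parameters by absolutely convergent integrals) we PROVE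
that each sign is the restriction of ONE entire, even function of the complex spectral parameter with the decay
required by Kuznetsov's formula — Iwaniec's hypotheses (1.63) on a spectral test function `h(t)`:
"`h(t)` even, holomorphic in the strip `|Im t| ≤ 1/2 + ε`, `h(t) ≪ (|t| + 1)^{-2-ε}`" — namely, for `f`
smooth with compact support in `(0, ∞)` (`KuzAdmissible`):

* `kuzTransforms_Tmi_entire` — an entire even `H₋` with `H₋(t) = Tmi f t` (`t ∈ ℝ`), `H₋(iy) = TmiX f y` (`y ∈ ℝ`,
  no restriction on `y`), the Bessel form `H₋(t) = 8cos(iπt)∫₀^∞ K_{2it}(x) f(x) dx/x` for ALL complex `t`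
  (so `H₋ = 2π K_f` with Iwaniec's (9.15)), and `‖H₋(t)‖ ≤ C_A (1 + |Re t|)^{-3}` on `|Im t| ≤ A`, every `A`;
* `kuzTransforms_Tpl_entire` — the same for the plus sign (`H₊(t) = Tpl f t`, `H₊(iy) = TplX f y`, strip bounds;
  for real `t ≠ 0` the `J`-Bessel form is `kuzTransforms_Tpl_eq_besselJ` of `…KuznetsovTransformsBesselJ`).

The two entire functions are `H∓(t) = 4𝔎_ρ(2it)` resp. `4𝔓_ρ(2it)` with `ρ = f/x` and
`𝔎_ρ(τ) = ∫_ℝ e^{τx} P_ρ(sinh x) dx` (`kMinus`), `𝔓_ρ(τ) = ∫_ℝ e^{τx} P_ρ(cosh x) dx` (`kPlus`), which converge for ALL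
`τ` because `P_ρ(s) ≪_m (1+|s|)^{-m}` (`norm_PcDeriv_le`). Proofs: (§S1) `‖𝓛ρ(cosh x)‖ ≤ ‖ρ‖₁e^{-a cosh x}`, so
`τ ↦ ∫e^{τx}𝓛ρ(cosh x)dx = 2∫K_τρ` is entire (differentiation under the integral); (§S2) `𝔎_ρ` is entire and
`cos(πτ/2)·2∫K_τρ = 𝔎_ρ(τ)` on the WHOLE plane (identity principle from `|Re τ| < 1`, `cos_mul_integral_Lap_cosh`);
(§S3) decay in strips by three integrations by parts: `𝔎_ρ(σ+iw) = 𝓐[e^{σx}P_ρ(sinh x)](-w)` and the explicit third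
derivative of `e^{σx}G₀(sinh x)` is integrable uniformly in `|σ| ≤ A`; (§S4) packaging for `Tmi`, `TmiX` straight
from their definitions; (§S5) the plus sign with `cosh` in place of `sinh`.

## References
* [Iwaniec2002] H. Iwaniec, *Spectral Methods of Automorphic Forms*, 2nd ed., GSM 53, AMS 2002, (1.63), PDF p. 24;
  §9.3–9.4 (9.12)–(9.18), PDF pp. 93–95 (held copy `book:iwaniec2002-spectral-methods-automorphic-forms`).
* [DeshouillersIwaniec1982] J.-M. Deshouillers, H. Iwaniec, Invent. Math. 70 (1982), Lemma 7.1 and (1.43)–(1.44).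

Literature: `IsSmoothPosTest`, `PcDeriv` (+ `norm_PcDeriv_le`, `hasDerivAt_PcDeriv`, `contDiff_PcDeriv(_sinh)`,
`Pc_eq_PcDeriv_zero`, `PcDeriv_neg`), `four_neg_eq_integral`, `norm_le_div_one_add_abs_pow`,
`integrable_of_le_div_one_add_abs_sinh_sq` (`KontorovichLebedevInversion.lean`); `Kuz.Lap`, `Kuz.Pc`, `Kuz.four`,
`Kuz.IsPosTest` (`cos_mul_integral_Lap_cosh`, `integral_cexp_mul_Lap_cosh_eq_besselK`, `differentiable_Lap`,
`norm_cexp_mul_ofReal_le`), `Kuz.pow_mul_norm_four_le'`, `Kuz.exp_abs_le_two_mul_cosh`, `Kuz.IsTest.cosh_le_abs_sinh_add_one`,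
`Kuz.abs_le_abs_sinh`, `Kuz.integral_comp_neg_real`, `Pk_zero_eq_Pc`, `exists_Icc_of_admissible`, `kuzTransforms`
(`…Sieve.BombieriFriedlanderIwaniecKuznetsovTransforms(Bessel)`); `integrable_polyaKernel_mul_exp`, `polyaKernel_zero`
(`PolyaBesselKernel.lean`); `besselK` (`BesselK.lean`).
Mathlib: `hasDerivAt_integral_of_dominated_loc_of_deriv_le`, `AnalyticOnNhd.eq_of_eventuallyEq`, `Real.fourier_iteratedDeriv`
(through `pow_mul_norm_four_le'`).
-/

noncomputable section

open MeasureTheory Set Filter Real Complex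
open scoped Topology FourierTransform ContDiff

namespace Literature.Analysis.FunctionSpaces

open Literature.NumberTheory.Sieve.BFI.L1.Kuz Literature.Analysis.Complex.Polya1926

/-! ### §S1. `𝓛ρ(cosh x)` decays like `e^{-a cosh x}`; `τ ↦ ∫ K_τ(u) ρ(u) du` is entire -/

namespace IsSmoothPosTest

variable {ρ : ℝ → ℂ} {a b : ℝ} (h : IsSmoothPosTest ρ a b)
include h

/-- `‖𝓛ρ(cosh x)‖ ≤ ‖ρ‖₁ e^{-a cosh x}` (the support of `ρ` starts at `a > 0`). [folklore] -/
theorem norm_Lap_cosh_le_exp (x : ℝ) : ‖Lap ρ (Real.cosh x : ℂ)‖ ≤ (∫ u, ‖ρ u‖) * Real.exp (-(a * Real.cosh x)) := by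
  rw [Lap, ← integral_mul_const]
  refine (norm_integral_le_integral_norm _).trans (integral_mono_of_nonneg (ae_of_all _ fun u => norm_nonneg _)
    (h.isPosTest.integrable.norm.mul_const _) (ae_of_all _ fun u => ?_))
  dsimp only
  rw [norm_mul, mul_comm]
  by_cases hu : ρ u = 0
  · simp [hu]
  · have hua : u ∈ Set.Icc a b := h.supp u hu
    apply mul_le_mul_of_nonneg_left _ (norm_nonneg _)
    rw [Complex.norm_exp]
    have : (-(u : ℂ) * (Real.cosh x : ℂ)).re = -(u * Real.cosh x) := by simp [Complex.mul_re]  -- re of product of reals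
    rw [this, Real.exp_le_exp]
    have := Real.cosh_pos x
    nlinarith [hua.1]

/-- **`τ ↦ ∫_ℝ e^{τx} 𝓛ρ(cosh x) dx` is entire** (domination by `e^{(R+1)|x|} ‖ρ‖₁ e^{-a cosh x}` on `‖τ‖ < R`). [folklore] -/
theorem differentiable_integral_cexp_mul_Lap_cosh :
    Differentiable ℂ fun τ : ℂ => ∫ x : ℝ, Complex.exp (τ * x) * Lap ρ (Real.cosh x : ℂ) := by
  intro τ₀
  set R : ℝ := ‖τ₀‖ + 1 with hR
  have hs : Metric.ball τ₀ 1 ∈ 𝓝 τ₀ := Metric.ball_mem_nhds _ one_pos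
  set F : ℂ → ℝ → ℂ := fun τ x => Complex.exp (τ * x) * Lap ρ (Real.cosh x : ℂ) with hF
  set F' : ℂ → ℝ → ℂ := fun τ x => (x : ℂ) * (Complex.exp (τ * x) * Lap ρ (Real.cosh x : ℂ)) with hF'
  set C : ℝ := ∫ u, ‖ρ u‖ with hC
  have hC0 : 0 ≤ C := integral_nonneg fun u => norm_nonneg _
  have hLc : Continuous fun x : ℝ => Lap ρ (Real.cosh x : ℂ) :=
    h.isPosTest.differentiable_Lap.continuous.comp (by fun_prop)
  have hcont : ∀ τ, Continuous (F τ) := fun τ => by simp only [hF]; exact (by fun_prop : Continuous fun x : ℝ => Complex.exp (τ * x)).mul hLc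
  have hcont' : ∀ τ, Continuous (F' τ) := fun τ => by simp only [hF']; exact (by fun_prop : Continuous fun x : ℝ => (x : ℂ)).mul ((by fun_prop : Continuous fun x : ℝ => Complex.exp (τ * x)).mul hLc)
  -- the dominating function
  set bound : ℝ → ℝ := fun x => polyaKernel 0 a x * Real.exp ((R + 1) * |x|) * C with hbound
  have hbi : Integrable bound := (integrable_polyaKernel_mul_exp h.pos 0 (R + 1)).mul_const C
  have key := hasDerivAt_integral_of_dominated_loc_of_deriv_le (μ := volume) (𝕜 := ℂ) (F := F) (F' := F') (bound := bound)
    (x₀ := τ₀) hs (Filter.Eventually.of_forall fun τ => (hcont τ).aestronglyMeasurable) ?_ (hcont' τ₀).aestronglyMeasurable ?_ hbi ?_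
  · exact key.2.differentiableAt
  · -- integrability of `F τ₀`
    refine hbi.mono' (hcont τ₀).aestronglyMeasurable (ae_of_all _ fun x => ?_)
    simp only [hF, hbound, polyaKernel_zero]
    rw [norm_mul]
    have h1 : ‖Complex.exp (τ₀ * x)‖ ≤ Real.exp ((R + 1) * |x|) := by
      refine (IsPosTest.norm_cexp_mul_ofReal_le τ₀ x).trans ?_
      rw [Real.exp_le_exp]
      have : |τ₀.re| ≤ ‖τ₀‖ := Complex.abs_re_le_norm τ₀
      nlinarith [abs_nonneg x]
    have h2 := h.norm_Lap_cosh_le_exp x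
    calc ‖Complex.exp (τ₀ * x)‖ * ‖Lap ρ (Real.cosh x : ℂ)‖ ≤ Real.exp ((R + 1) * |x|) * (C * Real.exp (-(a * Real.cosh x))) :=
          mul_le_mul h1 h2 (norm_nonneg _) (Real.exp_pos _).le
      _ = _ := by ring
  · -- the bound for `F'` on the ball
    refine ae_of_all _ fun x τ hτ => ?_
    simp only [hF', hbound, polyaKernel_zero]
    have hτR : ‖τ‖ ≤ R := by
      have : dist τ τ₀ < 1 := hτ
      rw [dist_eq_norm] at this
      have := norm_le_norm_add_norm_sub' τ τ₀
      linarith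
    rw [norm_mul, norm_mul, Complex.norm_real, Real.norm_eq_abs]
    have h1 : |x| * ‖Complex.exp (τ * x)‖ ≤ Real.exp ((R + 1) * |x|) := by
      have e1 := IsPosTest.norm_cexp_mul_ofReal_le τ x
      have e2 : |x| ≤ Real.exp |x| := by linarith [Real.add_one_le_exp |x|, abs_nonneg x]
      have : |τ.re| ≤ R := (Complex.abs_re_le_norm τ).trans hτR
      calc |x| * ‖Complex.exp (τ * x)‖ ≤ Real.exp |x| * Real.exp (|τ.re| * |x|) :=
            mul_le_mul e2 e1 (norm_nonneg _) (Real.exp_pos _).le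
        _ = Real.exp ((|τ.re| + 1) * |x|) := by rw [← Real.exp_add]; ring_nf
        _ ≤ Real.exp ((R + 1) * |x|) := by rw [Real.exp_le_exp]; nlinarith [abs_nonneg x]
    have h2 := h.norm_Lap_cosh_le_exp x
    calc |x| * (‖Complex.exp (τ * x)‖ * ‖Lap ρ (Real.cosh x : ℂ)‖) = (|x| * ‖Complex.exp (τ * x)‖) * ‖Lap ρ (Real.cosh x : ℂ)‖ := by ring
      _ ≤ Real.exp ((R + 1) * |x|) * (C * Real.exp (-(a * Real.cosh x))) := mul_le_mul h1 h2 (norm_nonneg _) (Real.exp_pos _).le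
      _ = _ := by ring
  · refine ae_of_all _ fun x τ _ => ?_
    simp only [hF, hF']
    have : HasDerivAt (fun τ : ℂ => Complex.exp (τ * x)) (Complex.exp (τ * x) * x) τ := by
      simpa using ((hasDerivAt_id τ).mul_const (x : ℂ)).cexp
    have := this.mul_const (Lap ρ (Real.cosh x : ℂ))
    refine this.congr_deriv ?_
    ring

/-- **`τ ↦ ∫ K_τ(u) ρ(u) du` is entire.** [folklore] -/
theorem differentiable_integral_besselK_mul : Differentiable ℂ fun τ : ℂ => ∫ u : ℝ, besselK τ u * ρ u := by
  have e : (fun τ : ℂ => ∫ u : ℝ, besselK τ u * ρ u) = fun τ => (1 / 2) * ∫ x : ℝ, Complex.exp (τ * x) * Lap ρ (Real.cosh x : ℂ) := by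
    funext τ
    rw [h.isPosTest.integral_cexp_mul_Lap_cosh_eq_besselK τ]
    ring
  rw [e]
  exact h.differentiable_integral_cexp_mul_Lap_cosh.const_mul _

end IsSmoothPosTest

/-! ### §S2. The minus transform in the complex parameter: `kMinus ρ τ = ∫ e^{τx} P_ρ(sinh x) dx` -/

/-- The minus-side profile transform `𝔎_ρ(τ) = ∫_ℝ e^{τx} P_ρ(sinh x) dx` (entire in `τ`); for `|Re τ| < 1` it equals
`cos(πτ/2) ∫ e^{τx} 𝓛ρ(cosh x) dx = 2cos(πτ/2) ∫ K_τ(u)ρ(u) du`. [folklore] -/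
def kMinus (ρ : ℝ → ℂ) (τ : ℂ) : ℂ := ∫ x : ℝ, Complex.exp (τ * x) * Pc ρ (Real.sinh x)

namespace IsSmoothPosTest

variable {ρ : ℝ → ℂ} {a b : ℝ} (h : IsSmoothPosTest ρ a b)
include h

/-- `‖P_ρ(sinh x)‖ ≤ C_m / (1 + |sinh x|)^m` for every `m`. [folklore] -/
theorem norm_Pc_sinh_le_pow (m : ℕ) : ∃ C : ℝ, 0 ≤ C ∧ ∀ x : ℝ, ‖Pc ρ (Real.sinh x)‖ ≤ C / (1 + |Real.sinh x|) ^ m := by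
  obtain ⟨C, hC0, hC⟩ := h.norm_PcDeriv_le 0 m
  exact ⟨C, hC0, fun x => by rw [h.Pc_eq_PcDeriv_zero]; exact hC _⟩

omit h in
/-- `e^{A|x|} ≤ 2^A (1 + |sinh x|)^A` for `A : ℕ`. [folklore] -/
theorem exp_nat_mul_abs_le (A : ℕ) (x : ℝ) : Real.exp (A * |x|) ≤ (2 : ℝ) ^ A * (1 + |Real.sinh x|) ^ A := by
  have h1 : Real.exp |x| ≤ 2 * (1 + |Real.sinh x|) := by
    have := exp_abs_le_two_mul_cosh x
    have := IsTest.cosh_le_abs_sinh_add_one x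
    linarith
  calc Real.exp (A * |x|) = Real.exp |x| ^ A := by rw [← Real.exp_nat_mul]
    _ ≤ (2 * (1 + |Real.sinh x|)) ^ A := pow_le_pow_left₀ (Real.exp_pos _).le h1 A
    _ = _ := mul_pow _ _ _

/-- For `‖τ‖ ≤ A`: `‖x^j e^{τx} P_ρ(sinh x)‖ ≤ C / (1+|sinh x|)²` (`j ≤ 1`), an integrable majorant. [folklore] -/
theorem norm_kMinus_integrand_le (A : ℕ) : ∃ C : ℝ, 0 ≤ C ∧ ∀ (τ : ℂ), ‖τ‖ ≤ A → ∀ x : ℝ,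
    (1 + |x|) * ‖Complex.exp (τ * x) * Pc ρ (Real.sinh x)‖ ≤ C / (1 + |Real.sinh x|) ^ 2 := by
  obtain ⟨C, hC0, hC⟩ := h.norm_Pc_sinh_le_pow (A + 3)
  refine ⟨2 ^ (A + 1) * C, by positivity, fun τ hτ x => ?_⟩
  rw [norm_mul]
  have e1 : (1 + |x|) * ‖Complex.exp (τ * x)‖ ≤ (2 : ℝ) ^ (A + 1) * (1 + |Real.sinh x|) ^ (A + 1) := by
    have h1 := IsPosTest.norm_cexp_mul_ofReal_le τ x
    have h2 : 1 + |x| ≤ Real.exp |x| := by linarith [Real.add_one_le_exp |x|]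
    have h3 : |τ.re| ≤ A := (Complex.abs_re_le_norm τ).trans hτ
    calc (1 + |x|) * ‖Complex.exp (τ * x)‖ ≤ Real.exp |x| * Real.exp (|τ.re| * |x|) :=
          mul_le_mul h2 h1 (norm_nonneg _) (Real.exp_pos _).le
      _ = Real.exp ((|τ.re| + 1) * |x|) := by rw [← Real.exp_add]; ring_nf
      _ ≤ Real.exp (((A + 1 : ℕ) : ℝ) * |x|) := by rw [Real.exp_le_exp]; push_cast; nlinarith [abs_nonneg x]
      _ ≤ _ := exp_nat_mul_abs_le (A + 1) x
  have hpos : 0 < 1 + |Real.sinh x| := by positivity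
  calc (1 + |x|) * (‖Complex.exp (τ * x)‖ * ‖Pc ρ (Real.sinh x)‖) = ((1 + |x|) * ‖Complex.exp (τ * x)‖) * ‖Pc ρ (Real.sinh x)‖ := by ring
    _ ≤ ((2 : ℝ) ^ (A + 1) * (1 + |Real.sinh x|) ^ (A + 1)) * (C / (1 + |Real.sinh x|) ^ (A + 3)) :=
        mul_le_mul e1 (hC x) (norm_nonneg _) (by positivity)
    _ = 2 ^ (A + 1) * C / (1 + |Real.sinh x|) ^ 2 := by
        rw [pow_add _ (A + 1) 2]; field_simp

/-- **`𝔎_ρ` is entire.** [folklore] -/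
theorem differentiable_kMinus : Differentiable ℂ (kMinus ρ) := by
  intro τ₀
  set A : ℕ := ⌈‖τ₀‖⌉₊ + 1 with hA
  have hAτ : ∀ τ ∈ Metric.ball τ₀ 1, ‖τ‖ ≤ A := by
    intro τ hτ
    have : dist τ τ₀ < 1 := hτ
    rw [dist_eq_norm] at this
    have h1 := norm_le_norm_add_norm_sub' τ τ₀
    have h2 := Nat.le_ceil ‖τ₀‖
    rw [hA]; push_cast; linarith
  obtain ⟨C, hC0, hC⟩ := h.norm_kMinus_integrand_le A
  have hs : Metric.ball τ₀ 1 ∈ 𝓝 τ₀ := Metric.ball_mem_nhds _ one_pos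
  set F : ℂ → ℝ → ℂ := fun τ x => Complex.exp (τ * x) * Pc ρ (Real.sinh x) with hF
  set F' : ℂ → ℝ → ℂ := fun τ x => (x : ℂ) * (Complex.exp (τ * x) * Pc ρ (Real.sinh x)) with hF'
  have hPcc : Continuous fun x : ℝ => Pc ρ (Real.sinh x) := by
    have e : (fun x : ℝ => Pc ρ (Real.sinh x)) = fun x => PcDeriv ρ 0 (Real.sinh x) := by
      funext x; exact h.Pc_eq_PcDeriv_zero _
    rw [e]; exact (h.continuous_PcDeriv 0).comp Real.continuous_sinh
  have hcont : ∀ τ, Continuous (F τ) := fun τ => by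
    simp only [hF]; exact (by fun_prop : Continuous fun x : ℝ => Complex.exp (τ * x)).mul hPcc
  have hcont' : ∀ τ, Continuous (F' τ) := fun τ => by
    simp only [hF']; exact (by fun_prop : Continuous fun x : ℝ => (x : ℂ)).mul ((by fun_prop : Continuous fun x : ℝ => Complex.exp (τ * x)).mul hPcc)
  set bound : ℝ → ℝ := fun x => C / (1 + |Real.sinh x|) ^ 2 with hbound
  have hbi : Integrable bound := by
    refine (integrable_inv_one_add_sq.const_mul C).mono' (by
      simp only [hbound]
      exact (continuous_const.div (by fun_prop) fun x => by positivity).aestronglyMeasurable) (ae_of_all _ fun x => ?_)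
    simp only [hbound]
    rw [Real.norm_eq_abs, abs_of_nonneg (by positivity), div_eq_mul_inv]
    apply mul_le_mul_of_nonneg_left _ hC0
    apply inv_anti₀ (by positivity)
    have := abs_le_abs_sinh x
    nlinarith [abs_nonneg x, sq_abs x]
  have key := hasDerivAt_integral_of_dominated_loc_of_deriv_le (μ := volume) (𝕜 := ℂ) (F := F) (F' := F') (bound := bound)
    (x₀ := τ₀) hs (Filter.Eventually.of_forall fun τ => (hcont τ).aestronglyMeasurable) ?_ (hcont' τ₀).aestronglyMeasurable ?_ hbi ?_
  · exact key.2.differentiableAt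
  · refine hbi.mono' (hcont τ₀).aestronglyMeasurable (ae_of_all _ fun x => ?_)
    have := hC τ₀ (hAτ τ₀ (Metric.mem_ball_self one_pos)) x
    have h0 : ‖Complex.exp (τ₀ * x) * Pc ρ (Real.sinh x)‖ ≤ (1 + |x|) * ‖Complex.exp (τ₀ * x) * Pc ρ (Real.sinh x)‖ :=
      le_mul_of_one_le_left (norm_nonneg _) (by linarith [abs_nonneg x])
    exact h0.trans this
  · refine ae_of_all _ fun x τ hτ => ?_
    have := hC τ (hAτ τ hτ) x
    simp only [hF']
    rw [norm_mul, Complex.norm_real, Real.norm_eq_abs]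
    have h0 : |x| * ‖Complex.exp (τ * x) * Pc ρ (Real.sinh x)‖ ≤ (1 + |x|) * ‖Complex.exp (τ * x) * Pc ρ (Real.sinh x)‖ :=
      mul_le_mul_of_nonneg_right (by linarith) (norm_nonneg _)
    exact h0.trans this
  · refine ae_of_all _ fun x τ _ => ?_
    simp only [hF, hF']
    have : HasDerivAt (fun τ : ℂ => Complex.exp (τ * x)) (Complex.exp (τ * x) * x) τ := by
      simpa using ((hasDerivAt_id τ).mul_const (x : ℂ)).cexp
    have := this.mul_const (Pc ρ (Real.sinh x))
    refine this.congr_deriv ?_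
    ring

/-- **The identity on the whole plane**: `cos(πτ/2) · 2∫ K_τ(u)ρ(u) du = 𝔎_ρ(τ)` for EVERY complex `τ`
(both sides are entire and agree on `|Re τ| < 1` by `cos_mul_integral_Lap_cosh`). [folklore] -/
theorem cos_mul_two_mul_integral_besselK (τ : ℂ) :
    Complex.cos (π / 2 * τ) * (2 * ∫ u : ℝ, besselK τ u * ρ u) = kMinus ρ τ := by
  set f : ℂ → ℂ := fun τ => Complex.cos (π / 2 * τ) * (2 * ∫ u : ℝ, besselK τ u * ρ u) with hf
  have hfa : AnalyticOnNhd ℂ f univ := by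
    have hd : Differentiable ℂ f :=
      ((Complex.differentiable_cos.comp (differentiable_id.const_mul _))).mul (h.differentiable_integral_besselK_mul.const_mul _)
    exact hd.differentiableOn.analyticOnNhd isOpen_univ
  have hga : AnalyticOnNhd ℂ (kMinus ρ) univ := h.differentiable_kMinus.differentiableOn.analyticOnNhd isOpen_univ
  have hU : IsOpen {τ : ℂ | |τ.re| < 1} := isOpen_lt (continuous_abs.comp Complex.continuous_re) continuous_const
  have h0 : (0 : ℂ) ∈ {τ : ℂ | |τ.re| < 1} := by simp
  have hev : f =ᶠ[𝓝 (0 : ℂ)] kMinus ρ := by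
    filter_upwards [hU.mem_nhds h0] with τ hτ
    simp only [hf, kMinus]
    rw [← h.isPosTest.cos_mul_integral_Lap_cosh τ hτ, h.isPosTest.integral_cexp_mul_Lap_cosh_eq_besselK τ]
  have := AnalyticOnNhd.eq_of_eventuallyEq hfa hga hev
  exact congrFun this τ

/-- `𝔎_ρ` is even. [folklore] -/
theorem kMinus_neg (τ : ℂ) : kMinus ρ (-τ) = kMinus ρ τ := by
  rw [kMinus, kMinus, ← integral_comp_neg_real]
  refine integral_congr_ae (ae_of_all _ fun x => ?_)
  dsimp only
  rw [Real.sinh_neg, show Pc ρ (-Real.sinh x) = Pc ρ (Real.sinh x) by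
    rw [h.Pc_eq_PcDeriv_zero, h.Pc_eq_PcDeriv_zero, PcDeriv_neg, pow_zero, one_mul]]
  push_cast; ring_nf

end IsSmoothPosTest

/-! ### §S3. Decay of `𝔎_ρ(σ + iw)` in `w`, uniformly for `|σ| ≤ A` -/

/-- Product rule up to order three with an exponential factor: for `g = e^{σx} G₀` with `G_j' = G_{j+1}`,
`g' = e^{σx}(σG₀ + G₁)`, `g'' = e^{σx}(σ²G₀ + 2σG₁ + G₂)`, `g''' = e^{σx}(σ³G₀ + 3σ²G₁ + 3σG₂ + G₃)`. [folklore] -/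
theorem iteratedDeriv_exp_mul_formulas {G0 G1 G2 G3 : ℝ → ℂ} (σ : ℝ)
    (h0 : ∀ x, HasDerivAt G0 (G1 x) x) (h1 : ∀ x, HasDerivAt G1 (G2 x) x) (h2 : ∀ x, HasDerivAt G2 (G3 x) x) :
    iteratedDeriv 1 (fun x => (Real.exp (σ * x) : ℂ) * G0 x) = (fun x => (Real.exp (σ * x) : ℂ) * (σ * G0 x + G1 x)) ∧
    iteratedDeriv 2 (fun x => (Real.exp (σ * x) : ℂ) * G0 x) =
      (fun x => (Real.exp (σ * x) : ℂ) * (σ ^ 2 * G0 x + 2 * σ * G1 x + G2 x)) ∧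
    iteratedDeriv 3 (fun x => (Real.exp (σ * x) : ℂ) * G0 x) =
      (fun x => (Real.exp (σ * x) : ℂ) * (σ ^ 3 * G0 x + 3 * σ ^ 2 * G1 x + 3 * σ * G2 x + G3 x)) := by
  have hE : ∀ x, HasDerivAt (fun x : ℝ => (Real.exp (σ * x) : ℂ)) ((Real.exp (σ * x) : ℂ) * σ) x := by
    intro x
    have h := ((Real.hasDerivAt_exp (σ * x)).comp x ((hasDerivAt_id x).const_mul σ)).ofReal_comp
    refine h.congr_deriv ?_
    push_cast; ring
  have d1 : ∀ x, HasDerivAt (fun x => (Real.exp (σ * x) : ℂ) * G0 x) ((Real.exp (σ * x) : ℂ) * (σ * G0 x + G1 x)) x := by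
    intro x; have := (hE x).mul (h0 x); refine this.congr_deriv ?_; ring
  have d2 : ∀ x, HasDerivAt (fun x => (Real.exp (σ * x) : ℂ) * (σ * G0 x + G1 x))
      ((Real.exp (σ * x) : ℂ) * (σ ^ 2 * G0 x + 2 * σ * G1 x + G2 x)) x := by
    intro x
    have := (hE x).mul (((h0 x).const_mul (σ : ℂ)).add (h1 x))
    refine this.congr_deriv ?_
    simp only [Pi.add_apply]
    ring
  have d3 : ∀ x, HasDerivAt (fun x => (Real.exp (σ * x) : ℂ) * (σ ^ 2 * G0 x + 2 * σ * G1 x + G2 x))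
      ((Real.exp (σ * x) : ℂ) * (σ ^ 3 * G0 x + 3 * σ ^ 2 * G1 x + 3 * σ * G2 x + G3 x)) x := by
    intro x
    have := (hE x).mul (((((h0 x).const_mul ((σ : ℂ) ^ 2))).add ((h1 x).const_mul (2 * (σ : ℂ)))).add (h2 x))
    refine this.congr_deriv ?_
    simp only [Pi.add_apply]
    ring
  have e1 : iteratedDeriv 1 (fun x => (Real.exp (σ * x) : ℂ) * G0 x) = fun x => (Real.exp (σ * x) : ℂ) * (σ * G0 x + G1 x) := by
    rw [iteratedDeriv_one]; funext x; exact (d1 x).deriv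
  have e2 : iteratedDeriv 2 (fun x => (Real.exp (σ * x) : ℂ) * G0 x) =
      fun x => (Real.exp (σ * x) : ℂ) * (σ ^ 2 * G0 x + 2 * σ * G1 x + G2 x) := by
    rw [iteratedDeriv_succ, e1]; funext x; exact (d2 x).deriv
  have e3 : iteratedDeriv 3 (fun x => (Real.exp (σ * x) : ℂ) * G0 x) =
      fun x => (Real.exp (σ * x) : ℂ) * (σ ^ 3 * G0 x + 3 * σ ^ 2 * G1 x + 3 * σ * G2 x + G3 x) := by
    rw [iteratedDeriv_succ, e2]; funext x; exact (d3 x).deriv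
  exact ⟨e1, e2, e3⟩

namespace IsSmoothPosTest

variable {ρ : ℝ → ℂ} {a b : ℝ} (h : IsSmoothPosTest ρ a b)
include h

/-- The chain `G_j` of derivatives of `G₀ = P_ρ ∘ sinh` (as functions with `HasDerivAt`). [folklore] -/
theorem hasDerivAt_chain :
    (∀ x, HasDerivAt (fun x => PcDeriv ρ 0 (Real.sinh x)) ((Real.cosh x : ℂ) * PcDeriv ρ 1 (Real.sinh x)) x) ∧
    (∀ x, HasDerivAt (fun x => (Real.cosh x : ℂ) * PcDeriv ρ 1 (Real.sinh x))
      ((Real.sinh x : ℂ) * PcDeriv ρ 1 (Real.sinh x) + (Real.cosh x : ℂ) ^ 2 * PcDeriv ρ 2 (Real.sinh x)) x) ∧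
    (∀ x, HasDerivAt (fun x => (Real.sinh x : ℂ) * PcDeriv ρ 1 (Real.sinh x) + (Real.cosh x : ℂ) ^ 2 * PcDeriv ρ 2 (Real.sinh x))
      ((Real.cosh x : ℂ) * PcDeriv ρ 1 (Real.sinh x) + 3 * (Real.cosh x : ℂ) * Real.sinh x * PcDeriv ρ 2 (Real.sinh x) +
        (Real.cosh x : ℂ) ^ 3 * PcDeriv ρ 3 (Real.sinh x)) x) := by
  have hcomp : ∀ k x, HasDerivAt (fun x => PcDeriv ρ k (Real.sinh x)) ((Real.cosh x : ℂ) * PcDeriv ρ (k + 1) (Real.sinh x)) x := by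
    intro k x
    have h1 := (h.hasDerivAt_PcDeriv k (Real.sinh x)).scomp x (Real.hasDerivAt_sinh x)
    have e : Real.cosh x • PcDeriv ρ (k + 1) (Real.sinh x) = (Real.cosh x : ℂ) * PcDeriv ρ (k + 1) (Real.sinh x) := Complex.real_smul
    rw [e] at h1
    exact h1
  have hch : ∀ x, HasDerivAt (fun x => (Real.cosh x : ℂ)) (Real.sinh x : ℂ) x := fun x => (Real.hasDerivAt_cosh x).ofReal_comp
  have hsh : ∀ x, HasDerivAt (fun x => (Real.sinh x : ℂ)) (Real.cosh x : ℂ) x := fun x => (Real.hasDerivAt_sinh x).ofReal_comp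
  refine ⟨hcomp 0, fun x => ?_, fun x => ?_⟩
  · have := (hch x).mul (hcomp 1 x)
    refine this.congr_deriv ?_
    ring
  · have := ((hsh x).mul (hcomp 1 x)).add (((hch x).pow 2).mul (hcomp 2 x))
    refine this.congr_deriv ?_
    simp only [Pi.pow_apply]
    push_cast; ring

/-- A weighted monomial `e^{σx} cosh^p sinh^q G_k(sinh x)` is integrable (`|σ| ≤ A`). [folklore] -/
theorem integrable_exp_term {σ : ℝ} {A : ℕ} (hσ : |σ| ≤ A) (k p q : ℕ) :
    Integrable fun x : ℝ => (Real.exp (σ * x) : ℂ) * ((Real.cosh x : ℂ) ^ p * (Real.sinh x : ℂ) ^ q * PcDeriv ρ k (Real.sinh x)) := by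
  obtain ⟨C, hC0, hC⟩ := h.norm_PcDeriv_le k (A + p + q + 2)
  refine integrable_of_le_div_one_add_abs_sinh_sq (C := 2 ^ A * C) ?_ fun x => ?_
  · exact (by fun_prop : Continuous fun x : ℝ => (Real.exp (σ * x) : ℂ)).mul
      ((by fun_prop : Continuous fun x : ℝ => (Real.cosh x : ℂ) ^ p * (Real.sinh x : ℂ) ^ q).mul
        ((h.continuous_PcDeriv k).comp Real.continuous_sinh))
  · rw [norm_mul, norm_mul, norm_mul, norm_pow, norm_pow, Complex.norm_real, Complex.norm_real, Complex.norm_real,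
      Real.norm_eq_abs, Real.norm_eq_abs, Real.norm_eq_abs, abs_of_pos (Real.exp_pos _), abs_of_pos (Real.cosh_pos x)]
    have hs : 0 ≤ |Real.sinh x| := abs_nonneg _
    have hc : Real.cosh x ≤ 1 + |Real.sinh x| := by linarith [IsTest.cosh_le_abs_sinh_add_one x]
    have h1 : Real.cosh x ^ p ≤ (1 + |Real.sinh x|) ^ p := pow_le_pow_left₀ (Real.cosh_pos x).le hc p
    have h2 : |Real.sinh x| ^ q ≤ (1 + |Real.sinh x|) ^ q := pow_le_pow_left₀ hs (by linarith) q
    have h3 := hC (Real.sinh x)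
    have h4 : Real.exp (σ * x) ≤ (2 : ℝ) ^ A * (1 + |Real.sinh x|) ^ A := by
      refine le_trans ?_ (exp_nat_mul_abs_le A x)
      rw [Real.exp_le_exp]
      calc σ * x ≤ |σ * x| := le_abs_self _
        _ = |σ| * |x| := abs_mul _ _
        _ ≤ A * |x| := mul_le_mul_of_nonneg_right hσ (abs_nonneg x)
    have hpos : 0 < (1 + |Real.sinh x|) := by positivity
    calc Real.exp (σ * x) * (Real.cosh x ^ p * |Real.sinh x| ^ q * ‖PcDeriv ρ k (Real.sinh x)‖)
        ≤ ((2 : ℝ) ^ A * (1 + |Real.sinh x|) ^ A) *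
            ((1 + |Real.sinh x|) ^ p * (1 + |Real.sinh x|) ^ q * (C / (1 + |Real.sinh x|) ^ (A + p + q + 2))) := by
          gcongr
      _ = 2 ^ A * C / (1 + |Real.sinh x|) ^ 2 := by
          rw [pow_add, pow_add, pow_add]; field_simp

/-- The weighted profile `g_σ(x) = e^{σx} G₀(sinh x)` is `C³` with `g_σ, …, g_σ‴` integrable (`|σ| ≤ A`), and
`|w|^m ‖𝓐g_σ(w)‖ ≤ ‖g_σ^{(m)}‖₁` for `m ≤ 3`. [folklore] -/
theorem pow_mul_norm_four_exp_mul_le {σ : ℝ} {A : ℕ} (hσ : |σ| ≤ A) {m : ℕ} (hm : m ≤ 3) (w : ℝ) :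
    |w| ^ m * ‖four (fun x => (Real.exp (σ * x) : ℂ) * PcDeriv ρ 0 (Real.sinh x)) w‖ ≤
      ∫ x, ‖iteratedDeriv m (fun x => (Real.exp (σ * x) : ℂ) * PcDeriv ρ 0 (Real.sinh x)) x‖ := by
  obtain ⟨c0, c1, c2⟩ := h.hasDerivAt_chain
  obtain ⟨e1, e2, e3⟩ := iteratedDeriv_exp_mul_formulas σ c0 c1 c2
  have hcd : ContDiff ℝ 3 fun x => (Real.exp (σ * x) : ℂ) * PcDeriv ρ 0 (Real.sinh x) := by
    have h1 : ContDiff ℝ 3 fun x : ℝ => (Real.exp (σ * x) : ℂ) :=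
      Complex.ofRealCLM.contDiff.comp ((Real.contDiff_exp.comp (contDiff_const.mul contDiff_id)).of_le le_top)
    exact h1.mul (h.contDiff_PcDeriv_sinh.of_le (WithTop.coe_le_coe.mpr le_top))
  refine pow_mul_norm_four_le' hcd (fun n hn => ?_) hm w
  -- integrability of the iterated derivatives
  have t000 := h.integrable_exp_term hσ 0 0 0
  have t110 := h.integrable_exp_term hσ 1 1 0
  have t101 := h.integrable_exp_term hσ 1 0 1
  have t220 := h.integrable_exp_term hσ 2 2 0
  have t211 := h.integrable_exp_term hσ 2 1 1
  have t330 := h.integrable_exp_term hσ 3 3 0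
  interval_cases n
  · simpa using t000
  · rw [e1]
    refine ((t000.const_mul (σ : ℂ)).add t110).congr (ae_of_all _ fun x => ?_)
    simp only [pow_zero, pow_one, one_mul, mul_one, Pi.add_apply]; ring
  · rw [e2]
    refine ((((t000.const_mul ((σ : ℂ) ^ 2)).add (t110.const_mul (2 * (σ : ℂ)))).add t101).add t220).congr
      (ae_of_all _ fun x => ?_)
    simp only [pow_zero, pow_one, one_mul, mul_one, Pi.add_apply]; ring
  · rw [e3]
    refine (((((((t000.const_mul ((σ : ℂ) ^ 3)).add (t110.const_mul (3 * (σ : ℂ) ^ 2))).add (t101.const_mul (3 * (σ : ℂ)))).add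
      (t220.const_mul (3 * (σ : ℂ)))).add t110).add (t211.const_mul 3)).add t330).congr (ae_of_all _ fun x => ?_)
    simp only [pow_zero, pow_one, one_mul, mul_one, Pi.add_apply]; ring

omit h in
/-- `e^{σx} ≤ e^{Ax} + e^{-Ax}` for `|σ| ≤ A`. [folklore] -/
theorem exp_le_exp_add_exp {σ : ℝ} {A : ℕ} (hσ : |σ| ≤ A) (x : ℝ) : Real.exp (σ * x) ≤ Real.exp (A * x) + Real.exp (-(A * x)) := by
  have h1 : σ * x ≤ (A : ℝ) * |x| := by
    calc σ * x ≤ |σ * x| := le_abs_self _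
      _ = |σ| * |x| := abs_mul _ _
      _ ≤ A * |x| := mul_le_mul_of_nonneg_right hσ (abs_nonneg x)
  rcases le_or_gt 0 x with hx | hx
  · rw [abs_of_nonneg hx] at h1
    linarith [Real.exp_le_exp.2 h1, Real.exp_pos (-(A * x))]
  · rw [abs_of_neg hx] at h1
    have : σ * x ≤ -(A * x) := by linarith
    linarith [Real.exp_le_exp.2 this, Real.exp_pos ((A : ℝ) * x)]

omit h in
/-- `∫ ‖e^{σx} F‖ ≤ ∫ (e^{Ax} + e^{-Ax}) ‖F‖` for `|σ| ≤ A`. [folklore] -/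
theorem integral_norm_exp_mul_le {σ : ℝ} {A : ℕ} (hσ : |σ| ≤ A) {F : ℝ → ℂ}
    (hF : Integrable fun x => (Real.exp (A * x) + Real.exp (-(A * x))) * ‖F x‖) :
    ∫ x, ‖(Real.exp (σ * x) : ℂ) * F x‖ ≤ ∫ x, (Real.exp (A * x) + Real.exp (-(A * x))) * ‖F x‖ := by
  refine integral_mono_of_nonneg (ae_of_all _ fun x => norm_nonneg _) hF (ae_of_all _ fun x => ?_)
  dsimp only
  rw [norm_mul, Complex.norm_real, Real.norm_eq_abs, abs_of_pos (Real.exp_pos _)]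
  exact mul_le_mul_of_nonneg_right (exp_le_exp_add_exp hσ x) (norm_nonneg _)

/-- The weight `(e^{Ax} + e^{-Ax}) ‖cosh^p sinh^q G_k(sinh x)‖` is integrable. [folklore] -/
theorem integrable_weight_term (A k p q : ℕ) :
    Integrable fun x : ℝ => (Real.exp (A * x) + Real.exp (-(A * x))) *
      ‖(Real.cosh x : ℂ) ^ p * (Real.sinh x : ℂ) ^ q * PcDeriv ρ k (Real.sinh x)‖ := by
  have hA1 : |(A : ℝ)| ≤ A := by rw [abs_of_nonneg (Nat.cast_nonneg A)]
  have hA2 : |(-(A : ℝ))| ≤ A := by rw [abs_neg, abs_of_nonneg (Nat.cast_nonneg A)]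
  have t1 := (h.integrable_exp_term hA1 k p q).norm
  have t2 := (h.integrable_exp_term hA2 k p q).norm
  refine (t1.add t2).congr (ae_of_all _ fun x => ?_)
  simp only [Pi.add_apply, norm_mul, Complex.norm_real, Real.norm_eq_abs, abs_of_pos (Real.exp_pos _), neg_mul]
  ring

/-- **Decay in horizontal strips**: for `|σ| ≤ A` and all real `w`,
`‖𝔎_ρ(σ + iw)‖ ≤ C_A / (1 + |w|)³`. [folklore] -/
theorem norm_kMinus_le (A : ℕ) : ∃ C : ℝ, 0 ≤ C ∧ ∀ σ w : ℝ, |σ| ≤ A →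
    ‖kMinus ρ ((σ : ℂ) + I * w)‖ ≤ C / (1 + |w|) ^ 3 := by
  -- the fixed profiles `G_j` and their weighted `L¹` norms
  set G0 : ℝ → ℂ := fun x => PcDeriv ρ 0 (Real.sinh x) with hG0
  set G1 : ℝ → ℂ := fun x => (Real.cosh x : ℂ) * PcDeriv ρ 1 (Real.sinh x) with hG1
  set G2 : ℝ → ℂ := fun x => (Real.sinh x : ℂ) * PcDeriv ρ 1 (Real.sinh x) + (Real.cosh x : ℂ) ^ 2 * PcDeriv ρ 2 (Real.sinh x) with hG2
  set G3 : ℝ → ℂ := fun x => (Real.cosh x : ℂ) * PcDeriv ρ 1 (Real.sinh x) + 3 * (Real.cosh x : ℂ) * Real.sinh x * PcDeriv ρ 2 (Real.sinh x) +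
    (Real.cosh x : ℂ) ^ 3 * PcDeriv ρ 3 (Real.sinh x) with hG3
  set W : ℝ → ℝ := fun x => Real.exp (A * x) + Real.exp (-(A * x)) with hW
  have hW0 : ∀ x, 0 ≤ W x := fun x => by positivity
  -- integrability of `W ‖G_j‖`
  have i0 : Integrable fun x => W x * ‖G0 x‖ := by
    simpa [hW, hG0] using h.integrable_weight_term A 0 0 0
  have i1 : Integrable fun x => W x * ‖G1 x‖ := by
    simpa [hW, hG1] using h.integrable_weight_term A 1 1 0
  have i2 : Integrable fun x => W x * ‖G2 x‖ := by
    have t1 := h.integrable_weight_term A 1 0 1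
    have t2 := h.integrable_weight_term A 2 2 0
    refine ((t1.add t2).mono' ((by fun_prop : Continuous W).mul ?_).aestronglyMeasurable (ae_of_all _ fun x => ?_))
    · exact ((by fun_prop : Continuous fun x : ℝ => (Real.sinh x : ℂ)).mul ((h.continuous_PcDeriv 1).comp Real.continuous_sinh)
        |>.add ((by fun_prop : Continuous fun x : ℝ => (Real.cosh x : ℂ) ^ 2).mul ((h.continuous_PcDeriv 2).comp Real.continuous_sinh))).norm
    · rw [Real.norm_eq_abs, abs_of_nonneg (by positivity)]
      simp only [hG2, Pi.add_apply, pow_zero, pow_one, one_mul, mul_one]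
      calc W x * ‖(Real.sinh x : ℂ) * PcDeriv ρ 1 (Real.sinh x) + (Real.cosh x : ℂ) ^ 2 * PcDeriv ρ 2 (Real.sinh x)‖
          ≤ W x * (‖(Real.sinh x : ℂ) * PcDeriv ρ 1 (Real.sinh x)‖ + ‖(Real.cosh x : ℂ) ^ 2 * PcDeriv ρ 2 (Real.sinh x)‖) :=
            mul_le_mul_of_nonneg_left (norm_add_le _ _) (hW0 x)
        _ = _ := by simp only [hW]; ring
  have i3 : Integrable fun x => W x * ‖G3 x‖ := by
    have t1 := h.integrable_weight_term A 1 1 0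
    have t2 := (h.integrable_weight_term A 2 1 1).const_mul 3
    have t3 := h.integrable_weight_term A 3 3 0
    refine (((t1.add t2).add t3).mono' ((by fun_prop : Continuous W).mul ?_).aestronglyMeasurable (ae_of_all _ fun x => ?_))
    · exact (((by fun_prop : Continuous fun x : ℝ => (Real.cosh x : ℂ)).mul ((h.continuous_PcDeriv 1).comp Real.continuous_sinh)).add
        ((by fun_prop : Continuous fun x : ℝ => 3 * (Real.cosh x : ℂ) * Real.sinh x).mul ((h.continuous_PcDeriv 2).comp Real.continuous_sinh))
        |>.add ((by fun_prop : Continuous fun x : ℝ => (Real.cosh x : ℂ) ^ 3).mul ((h.continuous_PcDeriv 3).comp Real.continuous_sinh))).norm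
    · rw [Real.norm_eq_abs, abs_of_nonneg (by positivity)]
      simp only [hG3, Pi.add_apply, pow_one]
      have e3 : ‖3 * (Real.cosh x : ℂ) * Real.sinh x * PcDeriv ρ 2 (Real.sinh x)‖ = 3 * ‖(Real.cosh x : ℂ) ^ 1 * (Real.sinh x : ℂ) ^ 1 * PcDeriv ρ 2 (Real.sinh x)‖ := by
        rw [pow_one, pow_one, show 3 * (Real.cosh x : ℂ) * Real.sinh x * PcDeriv ρ 2 (Real.sinh x) = 3 * ((Real.cosh x : ℂ) * Real.sinh x * PcDeriv ρ 2 (Real.sinh x)) by ring,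
          norm_mul, Complex.norm_ofNat]
      calc W x * ‖(Real.cosh x : ℂ) * PcDeriv ρ 1 (Real.sinh x) + 3 * (Real.cosh x : ℂ) * Real.sinh x * PcDeriv ρ 2 (Real.sinh x) +
            (Real.cosh x : ℂ) ^ 3 * PcDeriv ρ 3 (Real.sinh x)‖
          ≤ W x * (‖(Real.cosh x : ℂ) * PcDeriv ρ 1 (Real.sinh x)‖ + ‖3 * (Real.cosh x : ℂ) * Real.sinh x * PcDeriv ρ 2 (Real.sinh x)‖ +
            ‖(Real.cosh x : ℂ) ^ 3 * PcDeriv ρ 3 (Real.sinh x)‖) :=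
            mul_le_mul_of_nonneg_left ((norm_add_le _ _).trans (add_le_add (norm_add_le _ _) le_rfl)) (hW0 x)
        _ = _ := by rw [e3]; simp only [hW]; ring
  set N0 := ∫ x, W x * ‖G0 x‖ with hN0
  set N1 := ∫ x, W x * ‖G1 x‖ with hN1
  set N2 := ∫ x, W x * ‖G2 x‖ with hN2
  set N3 := ∫ x, W x * ‖G3 x‖ with hN3
  have hN00 : 0 ≤ N0 := integral_nonneg fun x => by positivity
  have hN10 : 0 ≤ N1 := integral_nonneg fun x => by positivity
  have hN20 : 0 ≤ N2 := integral_nonneg fun x => by positivity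
  have hN30 : 0 ≤ N3 := integral_nonneg fun x => by positivity
  set B : ℝ := (A : ℝ) ^ 3 * N0 + 3 * (A : ℝ) ^ 2 * N1 + 3 * A * N2 + N3 with hB
  have hB0 : 0 ≤ B := by positivity
  refine ⟨2 ^ 3 * (N0 + B), by positivity, fun σ w hσ => ?_⟩
  obtain ⟨c0, c1, c2⟩ := h.hasDerivAt_chain
  obtain ⟨e1, e2, e3⟩ := iteratedDeriv_exp_mul_formulas σ c0 c1 c2
  set g : ℝ → ℂ := fun x => (Real.exp (σ * x) : ℂ) * PcDeriv ρ 0 (Real.sinh x) with hg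
  have hrep : kMinus ρ ((σ : ℂ) + I * w) = four g (-w) := by
    rw [kMinus, four_neg_eq_integral]
    refine integral_congr_ae (ae_of_all _ fun x => ?_)
    simp only [hg, h.Pc_eq_PcDeriv_zero]
    rw [add_mul, Complex.exp_add, Complex.ofReal_exp]
    push_cast; ring
  -- `‖g‖₁ ≤ N0`
  have hL0 : ∫ x, ‖iteratedDeriv 0 g x‖ ≤ N0 := by
    simpa [hg] using integral_norm_exp_mul_le hσ (F := G0) i0
  -- `‖g‴‖₁ ≤ B`
  have hL3 : ∫ x, ‖iteratedDeriv 3 g x‖ ≤ B := by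
    rw [e3]
    have hpt : ∀ x : ℝ, ‖(Real.exp (σ * x) : ℂ) * (σ ^ 3 * G0 x + 3 * σ ^ 2 * G1 x + 3 * σ * G2 x + G3 x)‖ ≤
        (A : ℝ) ^ 3 * (W x * ‖G0 x‖) + 3 * (A : ℝ) ^ 2 * (W x * ‖G1 x‖) + 3 * A * (W x * ‖G2 x‖) + W x * ‖G3 x‖ := by
      intro x
      rw [norm_mul, Complex.norm_real, Real.norm_eq_abs, abs_of_pos (Real.exp_pos _)]
      have hEW := exp_le_exp_add_exp hσ x
      have hσA : |σ| ≤ (A : ℝ) := hσ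
      have hin : ‖(σ : ℂ) ^ 3 * G0 x + 3 * σ ^ 2 * G1 x + 3 * σ * G2 x + G3 x‖ ≤
          (A : ℝ) ^ 3 * ‖G0 x‖ + 3 * (A : ℝ) ^ 2 * ‖G1 x‖ + 3 * A * ‖G2 x‖ + ‖G3 x‖ := by
        refine (norm_add_le _ _).trans (add_le_add ((norm_add_le _ _).trans (add_le_add ((norm_add_le _ _).trans (add_le_add ?_ ?_)) ?_)) le_rfl)
        · rw [norm_mul, norm_pow, Complex.norm_real, Real.norm_eq_abs]; gcongr
        · rw [norm_mul, norm_mul, norm_pow, Complex.norm_real, Real.norm_eq_abs, Complex.norm_ofNat]; gcongr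
        · rw [norm_mul, norm_mul, Complex.norm_real, Real.norm_eq_abs, Complex.norm_ofNat]; gcongr
      have hA0 : (0 : ℝ) ≤ A := Nat.cast_nonneg A
      calc Real.exp (σ * x) * ‖(σ : ℂ) ^ 3 * G0 x + 3 * σ ^ 2 * G1 x + 3 * σ * G2 x + G3 x‖
          ≤ W x * ((A : ℝ) ^ 3 * ‖G0 x‖ + 3 * (A : ℝ) ^ 2 * ‖G1 x‖ + 3 * A * ‖G2 x‖ + ‖G3 x‖) :=
            mul_le_mul hEW hin (norm_nonneg _) (hW0 x)
        _ = _ := by ring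
    have hI01 : Integrable fun x => (A : ℝ) ^ 3 * (W x * ‖G0 x‖) + 3 * (A : ℝ) ^ 2 * (W x * ‖G1 x‖) :=
      (i0.const_mul _).add (i1.const_mul _)
    have hI012 : Integrable fun x => (A : ℝ) ^ 3 * (W x * ‖G0 x‖) + 3 * (A : ℝ) ^ 2 * (W x * ‖G1 x‖) + 3 * A * (W x * ‖G2 x‖) :=
      hI01.add (i2.const_mul _)
    have hint : Integrable fun x => (A : ℝ) ^ 3 * (W x * ‖G0 x‖) + 3 * (A : ℝ) ^ 2 * (W x * ‖G1 x‖) + 3 * A * (W x * ‖G2 x‖) + W x * ‖G3 x‖ :=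
      hI012.add i3
    calc (∫ x, ‖(Real.exp (σ * x) : ℂ) * (σ ^ 3 * G0 x + 3 * σ ^ 2 * G1 x + 3 * σ * G2 x + G3 x)‖)
        ≤ ∫ x, ((A : ℝ) ^ 3 * (W x * ‖G0 x‖) + 3 * (A : ℝ) ^ 2 * (W x * ‖G1 x‖) + 3 * A * (W x * ‖G2 x‖) + W x * ‖G3 x‖) :=
          integral_mono_of_nonneg (ae_of_all _ fun x => norm_nonneg _) hint (ae_of_all _ hpt)
      _ = B := by
          rw [integral_add hI012 i3, integral_add hI01 (i2.const_mul _), integral_add (i0.const_mul _) (i1.const_mul _),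
            integral_const_mul, integral_const_mul, integral_const_mul]
  have hbd := norm_le_div_one_add_abs_pow (G := fun w => four g (-w)) (A := N0) (B := B) (m := 3)
    (fun w => by
      have := h.pow_mul_norm_four_exp_mul_le hσ (m := 0) (by norm_num) (-w)
      rw [pow_zero, one_mul] at this
      exact this.trans hL0)
    (fun w => by
      have := h.pow_mul_norm_four_exp_mul_le hσ (m := 3) le_rfl (-w)
      rw [abs_neg] at this
      exact this.trans hL3) w
  rw [hrep]
  exact hbd

end IsSmoothPosTest

/-! ### §S4. The minus transforms `f̌(t)`, `f̌(iy)` as values of one entire function -/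

/-- For `f` smooth with compact support in `(0, ∞)`, `ρ = f/x` is a smooth test function. [folklore] -/
theorem isSmoothPosTest_div {f : ℝ → ℂ} (hf : ContDiff ℝ ∞ f) (hc : HasCompactSupport f) (hs : tsupport f ⊆ Set.Ioi 0) :
    ∃ a b : ℝ, IsSmoothPosTest (fun x => f x / (x : ℂ)) a b := by
  obtain ⟨a, b, ha, hab, hsupp⟩ := Literature.NumberTheory.Sieve.BFI.L1.exists_Icc_of_admissible hc hs
  refine ⟨a, b, ha, hab, ?_, fun x hx => hsupp x (fun h0 => hx (by rw [h0, zero_div]))⟩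
  rw [contDiff_iff_contDiffAt]
  intro x
  by_cases hx : x < a
  · have hev : (fun u : ℝ => f u / (u : ℂ)) =ᶠ[𝓝 x] fun _ => 0 := by
      filter_upwards [Iio_mem_nhds hx] with u hu
      have : f u = 0 := by
        by_contra hne; exact absurd (hsupp u hne).1 (not_le.2 hu)
      rw [this, zero_div]
    exact contDiffAt_const.congr_of_eventuallyEq hev
  · have hx0 : (x : ℂ) ≠ 0 := by
      have : 0 < x := ha.trans_le (not_lt.1 hx)
      exact_mod_cast this.ne'
    have hinv : ContDiffAt ℝ ∞ (fun u : ℝ => (u : ℂ)⁻¹) x :=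
      (contDiffAt_inv ℝ hx0).comp x Complex.ofRealCLM.contDiff.contDiffAt
    have := hf.contDiffAt.mul hinv
    simpa only [div_eq_mul_inv] using this

namespace IsSmoothPosTest

variable {ρ : ℝ → ℂ} {a b : ℝ} (h : IsSmoothPosTest ρ a b)
include h

/-- Integrability of `e^{τx} P_ρ(sinh x)` for every complex `τ`. [folklore] -/
theorem integrable_kMinus_integrand (τ : ℂ) : Integrable fun x : ℝ => Complex.exp (τ * x) * Pc ρ (Real.sinh x) := by
  set A : ℕ := ⌈‖τ‖⌉₊ with hA
  have hτ : ‖τ‖ ≤ A := Nat.le_ceil _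
  obtain ⟨C, hC0, hC⟩ := h.norm_kMinus_integrand_le A
  have hPcc : Continuous fun x : ℝ => Pc ρ (Real.sinh x) := by
    have e : (fun x : ℝ => Pc ρ (Real.sinh x)) = fun x => PcDeriv ρ 0 (Real.sinh x) := by
      funext x; exact h.Pc_eq_PcDeriv_zero _
    rw [e]; exact (h.continuous_PcDeriv 0).comp Real.continuous_sinh
  refine integrable_of_le_div_one_add_abs_sinh_sq (C := C) ((by fun_prop : Continuous fun x : ℝ => Complex.exp (τ * x)).mul hPcc)
    fun x => ?_
  have := hC τ hτ x
  exact le_trans (le_mul_of_one_le_left (norm_nonneg _) (by linarith [abs_nonneg x])) this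

/-- `4∫ cos(2tξ) P_ρ(sinh ξ) dξ = 4 𝔎_ρ(2it)` (real `t`). [folklore] -/
theorem four_mul_integral_cos_mul_Pc_sinh (t : ℝ) :
    4 * ∫ ξ : ℝ, (Real.cos (2 * t * ξ) : ℂ) * Pc ρ (Real.sinh ξ) = 4 * kMinus ρ (2 * I * t) := by
  have i1 := h.integrable_kMinus_integrand (2 * I * t)
  have i2 := h.integrable_kMinus_integrand (-(2 * I * t))
  have e : (∫ ξ : ℝ, (Real.cos (2 * t * ξ) : ℂ) * Pc ρ (Real.sinh ξ)) = (kMinus ρ (2 * I * t) + kMinus ρ (-(2 * I * t))) / 2 := by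
    rw [kMinus, kMinus, ← integral_add i1 i2, ← integral_div]
    refine integral_congr_ae (ae_of_all _ fun ξ => ?_)
    dsimp only
    rw [Complex.ofReal_cos, Complex.cos]
    push_cast; ring_nf
  rw [e, h.kMinus_neg]; ring

/-- `4∫ cosh(2yξ) P_ρ(sinh ξ) dξ = 4 𝔎_ρ(2y)` (real `y`). [folklore] -/
theorem four_mul_integral_cosh_mul_Pc_sinh (y : ℝ) :
    4 * ∫ ξ : ℝ, (Real.cosh (2 * y * ξ) : ℂ) * Pc ρ (Real.sinh ξ) = 4 * kMinus ρ (2 * y) := by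
  have i1 := h.integrable_kMinus_integrand (2 * y)
  have i2 := h.integrable_kMinus_integrand (-(2 * y))
  have e : (∫ ξ : ℝ, (Real.cosh (2 * y * ξ) : ℂ) * Pc ρ (Real.sinh ξ)) = (kMinus ρ (2 * y) + kMinus ρ (-(2 * y))) / 2 := by
    rw [kMinus, kMinus, ← integral_add i1 i2, ← integral_div]
    refine integral_congr_ae (ae_of_all _ fun ξ => ?_)
    dsimp only
    rw [Complex.ofReal_cosh, Complex.cosh]
    push_cast; ring_nf
  rw [e, h.kMinus_neg]; ring

end IsSmoothPosTest

open Literature.NumberTheory.Sieve.BFI.L1 in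
/-- **The minus transform is one entire function of the spectral parameter.** For `f` smooth with compact
support in `(0, ∞)` there is an entire, even `H : ℂ → ℂ` with `H(t) = f̌(t) = kuzTransforms.Tmi f t` for real `t`,
`H(iy) = kuzTransforms.TmiX f y` for real `y`, the Bessel form `H(t) = 8 cos(iπt) ∫₀^∞ K_{2it}(x) f(x) dx/x` for ALL
complex `t`, and the strip bounds `‖H(t)‖ ≤ C_A (1 + |Re t|)^{-3}` for `|Im t| ≤ A` — the hypotheses (1.63) of
[Iwaniec2002] on a test function of Kuznetsov's formula ("`h(t)` even, holomorphic in `|Im t| ≤ 1/2 + ε`,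
`h(t) ≪ (|t|+1)^{-2-ε}`") for `h = f̌`, i.e. for `K_f` of (9.15) with `f = (π/2)f`.
[cite: Iwaniec2002, (1.63), (9.14)–(9.15); DeshouillersIwaniec1982, Lemma 7.1] -/
theorem kuzTransforms_Tmi_entire {f : ℝ → ℂ} (hf : ContDiff ℝ ∞ f) (hc : HasCompactSupport f) (hs : tsupport f ⊆ Set.Ioi 0) :
    ∃ H : ℂ → ℂ, Differentiable ℂ H ∧ (∀ t : ℂ, H (-t) = H t) ∧
      (∀ t : ℝ, H t = kuzTransforms.Tmi f t) ∧ (∀ y : ℝ, H (I * y) = kuzTransforms.TmiX f y) ∧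
      (∀ t : ℂ, H t = 8 * Complex.cos (π * (I * t)) * ∫ u in Set.Ioi (0 : ℝ), besselK (2 * I * t) u * (f u / u)) ∧
      ∀ A : ℕ, ∃ C : ℝ, 0 ≤ C ∧ ∀ t : ℂ, |t.im| ≤ A → ‖H t‖ ≤ C / (1 + |t.re|) ^ 3 := by
  obtain ⟨a, b, hρ⟩ := isSmoothPosTest_div hf hc hs
  set ρ : ℝ → ℂ := fun x => f x / (x : ℂ) with hρdef
  refine ⟨fun t => 4 * kMinus ρ (2 * I * t), ?_, ?_, ?_, ?_, ?_, ?_⟩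
  · exact (hρ.differentiable_kMinus.comp ((differentiable_const _).mul differentiable_id)).const_mul _
  · intro t
    show 4 * kMinus ρ (2 * I * -t) = 4 * kMinus ρ (2 * I * t)
    rw [show 2 * I * -t = -(2 * I * t) by ring, hρ.kMinus_neg]
  · intro t
    show 4 * kMinus ρ (2 * I * t) = 4 * ∫ ξ : ℝ, (Real.cos (2 * t * ξ) : ℂ) * Kuz.IsTest.Hm f ξ
    rw [← hρ.four_mul_integral_cos_mul_Pc_sinh t]
    congr 1
    refine integral_congr_ae (ae_of_all _ fun ξ => ?_)
    dsimp only
    rw [Kuz.IsTest.Hm, Pk_zero_eq_Pc hf.continuous hc hs]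
  · intro y
    show 4 * kMinus ρ (2 * I * (I * y)) = 4 * ∫ ξ : ℝ, (Real.cosh (2 * y * ξ) : ℂ) * Kuz.IsTest.Hm f ξ
    rw [show 2 * I * (I * (y : ℂ)) = -(2 * y) by ring_nf; rw [Complex.I_sq]; ring, hρ.kMinus_neg,
      ← hρ.four_mul_integral_cosh_mul_Pc_sinh y]
    congr 1
    refine integral_congr_ae (ae_of_all _ fun ξ => ?_)
    dsimp only
    rw [Kuz.IsTest.Hm, Pk_zero_eq_Pc hf.continuous hc hs]
  · intro t
    show 4 * kMinus ρ (2 * I * t) = _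
    rw [← hρ.cos_mul_two_mul_integral_besselK (2 * I * t)]
    have hset : ∫ u in Set.Ioi (0 : ℝ), besselK (2 * I * t) u * (f u / u) = ∫ u : ℝ, besselK (2 * I * t) u * ρ u := by
      apply setIntegral_eq_integral_of_forall_compl_eq_zero
      intro u hu
      have : f u = 0 := image_eq_zero_of_notMem_tsupport (fun h' => hu (hs h'))
      simp [this]
    rw [hset, show (π : ℂ) / 2 * (2 * I * t) = π * (I * t) by ring]
    ring
  · intro A
    obtain ⟨C, hC0, hC⟩ := hρ.norm_kMinus_le (2 * A)
    refine ⟨4 * C, by positivity, fun t ht => ?_⟩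
    show ‖4 * kMinus ρ (2 * I * t)‖ ≤ _
    have e : 2 * I * t = ((-2 * t.im : ℝ) : ℂ) + I * ((2 * t.re : ℝ) : ℂ) := by
      apply Complex.ext <;> simp
    have hσ : |(-2 * t.im)| ≤ ((2 * A : ℕ) : ℝ) := by
      rw [abs_mul, abs_neg, abs_two]; push_cast; linarith
    have := hC (-2 * t.im) (2 * t.re) hσ
    rw [e, norm_mul, Complex.norm_ofNat]
    have hpos : 0 < (1 + |t.re|) ^ 3 := by positivity
    calc 4 * ‖kMinus ρ (((-2 * t.im : ℝ) : ℂ) + I * ((2 * t.re : ℝ) : ℂ))‖ ≤ 4 * (C / (1 + |2 * t.re|) ^ 3) := by gcongr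
      _ ≤ 4 * (C / (1 + |t.re|) ^ 3) := by
          apply mul_le_mul_of_nonneg_left _ (by norm_num)
          apply div_le_div_of_nonneg_left hC0 hpos
          apply pow_le_pow_left₀ (by positivity)
          rw [abs_mul, abs_two]; linarith [abs_nonneg t.re]
      _ = 4 * C / (1 + |t.re|) ^ 3 := by ring

/-! ### §S5. The plus transform in the complex parameter: `kPlus ρ τ = ∫ e^{τx} P_ρ(cosh x) dx` -/

/-- The plus-side profile transform `𝔓_ρ(τ) = ∫_ℝ e^{τx} P_ρ(cosh x) dx` (entire in `τ`); for real `t ≠ 0`,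
`4𝔓_ρ(2it) = kuzTransforms.Tpl` is the `J`-Bessel transform of `…KuznetsovTransformsBesselJ`. [folklore] -/
def kPlus (ρ : ℝ → ℂ) (τ : ℂ) : ℂ := ∫ x : ℝ, Complex.exp (τ * x) * Pc ρ (Real.cosh x)

namespace IsSmoothPosTest

variable {ρ : ℝ → ℂ} {a b : ℝ} (h : IsSmoothPosTest ρ a b)
include h

/-- `‖G_k(cosh x)‖ ≤ C_m/(1 + |sinh x|)^m` (`cosh x ≥ |sinh x|`). [folklore] -/
theorem norm_PcDeriv_cosh_le (k m : ℕ) : ∃ C : ℝ, 0 ≤ C ∧ ∀ x : ℝ, ‖PcDeriv ρ k (Real.cosh x)‖ ≤ C / (1 + |Real.sinh x|) ^ m := by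
  obtain ⟨C, hC0, hC⟩ := h.norm_PcDeriv_le k m
  refine ⟨C, hC0, fun x => (hC _).trans ?_⟩
  apply div_le_div_of_nonneg_left hC0 (by positivity)
  apply pow_le_pow_left₀ (by positivity)
  rw [abs_of_pos (Real.cosh_pos x), Real.abs_sinh, ← Real.cosh_abs]
  linarith [Real.sinh_lt_cosh |x|]

/-- `‖P_ρ(cosh x)‖ ≤ C_m/(1+|sinh x|)^m`. [folklore] -/
theorem norm_Pc_cosh_le_pow (m : ℕ) : ∃ C : ℝ, 0 ≤ C ∧ ∀ x : ℝ, ‖Pc ρ (Real.cosh x)‖ ≤ C / (1 + |Real.sinh x|) ^ m := by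
  obtain ⟨C, hC0, hC⟩ := h.norm_PcDeriv_cosh_le 0 m
  exact ⟨C, hC0, fun x => by rw [h.Pc_eq_PcDeriv_zero]; exact hC _⟩

/-- `P_ρ ∘ cosh` is continuous. [folklore] -/
theorem continuous_Pc_cosh : Continuous fun x : ℝ => Pc ρ (Real.cosh x) := by
  have e : (fun x : ℝ => Pc ρ (Real.cosh x)) = fun x => PcDeriv ρ 0 (Real.cosh x) := by
    funext x; exact h.Pc_eq_PcDeriv_zero _
  rw [e]; exact (h.continuous_PcDeriv 0).comp Real.continuous_cosh

/-- For `‖τ‖ ≤ A`: `(1+|x|)‖e^{τx} P_ρ(cosh x)‖ ≤ C/(1+|sinh x|)²`. [folklore] -/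
theorem norm_kPlus_integrand_le (A : ℕ) : ∃ C : ℝ, 0 ≤ C ∧ ∀ (τ : ℂ), ‖τ‖ ≤ A → ∀ x : ℝ,
    (1 + |x|) * ‖Complex.exp (τ * x) * Pc ρ (Real.cosh x)‖ ≤ C / (1 + |Real.sinh x|) ^ 2 := by
  obtain ⟨C, hC0, hC⟩ := h.norm_Pc_cosh_le_pow (A + 3)
  refine ⟨2 ^ (A + 1) * C, by positivity, fun τ hτ x => ?_⟩
  rw [norm_mul]
  have e1 : (1 + |x|) * ‖Complex.exp (τ * x)‖ ≤ (2 : ℝ) ^ (A + 1) * (1 + |Real.sinh x|) ^ (A + 1) := by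
    have h1 := IsPosTest.norm_cexp_mul_ofReal_le τ x
    have h2 : 1 + |x| ≤ Real.exp |x| := by linarith [Real.add_one_le_exp |x|]
    have h3 : |τ.re| ≤ A := (Complex.abs_re_le_norm τ).trans hτ
    calc (1 + |x|) * ‖Complex.exp (τ * x)‖ ≤ Real.exp |x| * Real.exp (|τ.re| * |x|) :=
          mul_le_mul h2 h1 (norm_nonneg _) (Real.exp_pos _).le
      _ = Real.exp ((|τ.re| + 1) * |x|) := by rw [← Real.exp_add]; ring_nf
      _ ≤ Real.exp (((A + 1 : ℕ) : ℝ) * |x|) := by rw [Real.exp_le_exp]; push_cast; nlinarith [abs_nonneg x]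
      _ ≤ _ := exp_nat_mul_abs_le (A + 1) x
  calc (1 + |x|) * (‖Complex.exp (τ * x)‖ * ‖Pc ρ (Real.cosh x)‖) = ((1 + |x|) * ‖Complex.exp (τ * x)‖) * ‖Pc ρ (Real.cosh x)‖ := by ring
    _ ≤ ((2 : ℝ) ^ (A + 1) * (1 + |Real.sinh x|) ^ (A + 1)) * (C / (1 + |Real.sinh x|) ^ (A + 3)) :=
        mul_le_mul e1 (hC x) (norm_nonneg _) (by positivity)
    _ = 2 ^ (A + 1) * C / (1 + |Real.sinh x|) ^ 2 := by
        rw [pow_add _ (A + 1) 2]; field_simp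

/-- Integrability of `e^{τx} P_ρ(cosh x)` for every complex `τ`. [folklore] -/
theorem integrable_kPlus_integrand (τ : ℂ) : Integrable fun x : ℝ => Complex.exp (τ * x) * Pc ρ (Real.cosh x) := by
  set A : ℕ := ⌈‖τ‖⌉₊ with hA
  have hτ : ‖τ‖ ≤ A := Nat.le_ceil _
  obtain ⟨C, hC0, hC⟩ := h.norm_kPlus_integrand_le A
  refine integrable_of_le_div_one_add_abs_sinh_sq (C := C) ((by fun_prop : Continuous fun x : ℝ => Complex.exp (τ * x)).mul h.continuous_Pc_cosh)
    fun x => ?_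
  have := hC τ hτ x
  exact le_trans (le_mul_of_one_le_left (norm_nonneg _) (by linarith [abs_nonneg x])) this

/-- **`𝔓_ρ` is entire.** [folklore] -/
theorem differentiable_kPlus : Differentiable ℂ (kPlus ρ) := by
  intro τ₀
  set A : ℕ := ⌈‖τ₀‖⌉₊ + 1 with hA
  have hAτ : ∀ τ ∈ Metric.ball τ₀ 1, ‖τ‖ ≤ A := by
    intro τ hτ
    have : dist τ τ₀ < 1 := hτ
    rw [dist_eq_norm] at this
    have h1 := norm_le_norm_add_norm_sub' τ τ₀
    have h2 := Nat.le_ceil ‖τ₀‖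
    rw [hA]; push_cast; linarith
  obtain ⟨C, hC0, hC⟩ := h.norm_kPlus_integrand_le A
  have hs : Metric.ball τ₀ 1 ∈ 𝓝 τ₀ := Metric.ball_mem_nhds _ one_pos
  set F : ℂ → ℝ → ℂ := fun τ x => Complex.exp (τ * x) * Pc ρ (Real.cosh x) with hF
  set F' : ℂ → ℝ → ℂ := fun τ x => (x : ℂ) * (Complex.exp (τ * x) * Pc ρ (Real.cosh x)) with hF'
  have hPcc := h.continuous_Pc_cosh
  have hcont : ∀ τ, Continuous (F τ) := fun τ => by
    simp only [hF]; exact (by fun_prop : Continuous fun x : ℝ => Complex.exp (τ * x)).mul hPcc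
  have hcont' : ∀ τ, Continuous (F' τ) := fun τ => by
    simp only [hF']; exact (by fun_prop : Continuous fun x : ℝ => (x : ℂ)).mul ((by fun_prop : Continuous fun x : ℝ => Complex.exp (τ * x)).mul hPcc)
  set bound : ℝ → ℝ := fun x => C / (1 + |Real.sinh x|) ^ 2 with hbound
  have hbi : Integrable bound := by
    refine (integrable_inv_one_add_sq.const_mul C).mono' (by
      simp only [hbound]
      exact (continuous_const.div (by fun_prop) fun x => by positivity).aestronglyMeasurable) (ae_of_all _ fun x => ?_)
    simp only [hbound]
    rw [Real.norm_eq_abs, abs_of_nonneg (by positivity), div_eq_mul_inv]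
    apply mul_le_mul_of_nonneg_left _ hC0
    apply inv_anti₀ (by positivity)
    have := abs_le_abs_sinh x
    nlinarith [abs_nonneg x, sq_abs x]
  have key := hasDerivAt_integral_of_dominated_loc_of_deriv_le (μ := volume) (𝕜 := ℂ) (F := F) (F' := F') (bound := bound)
    (x₀ := τ₀) hs (Filter.Eventually.of_forall fun τ => (hcont τ).aestronglyMeasurable) ?_ (hcont' τ₀).aestronglyMeasurable ?_ hbi ?_
  · exact key.2.differentiableAt
  · refine hbi.mono' (hcont τ₀).aestronglyMeasurable (ae_of_all _ fun x => ?_)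
    have := hC τ₀ (hAτ τ₀ (Metric.mem_ball_self one_pos)) x
    exact ((le_mul_of_one_le_left (norm_nonneg _) (by linarith [abs_nonneg x]))).trans this
  · refine ae_of_all _ fun x τ hτ => ?_
    have := hC τ (hAτ τ hτ) x
    simp only [hF']
    rw [norm_mul, Complex.norm_real, Real.norm_eq_abs]
    exact (mul_le_mul_of_nonneg_right (by linarith) (norm_nonneg _)).trans this
  · refine ae_of_all _ fun x τ _ => ?_
    simp only [hF, hF']
    have : HasDerivAt (fun τ : ℂ => Complex.exp (τ * x)) (Complex.exp (τ * x) * x) τ := by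
      simpa using ((hasDerivAt_id τ).mul_const (x : ℂ)).cexp
    have := this.mul_const (Pc ρ (Real.cosh x))
    refine this.congr_deriv ?_
    ring

omit h in
/-- `𝔓_ρ` is even. [folklore] -/
theorem kPlus_neg (τ : ℂ) : kPlus ρ (-τ) = kPlus ρ τ := by
  rw [kPlus, kPlus, ← integral_comp_neg_real]
  refine integral_congr_ae (ae_of_all _ fun x => ?_)
  dsimp only
  rw [Real.cosh_neg]
  push_cast; ring_nf

/-- The chain of derivatives of `G₀ ∘ cosh`. [folklore] -/
theorem hasDerivAt_chain_cosh :
    (∀ x, HasDerivAt (fun x => PcDeriv ρ 0 (Real.cosh x)) ((Real.sinh x : ℂ) * PcDeriv ρ 1 (Real.cosh x)) x) ∧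
    (∀ x, HasDerivAt (fun x => (Real.sinh x : ℂ) * PcDeriv ρ 1 (Real.cosh x))
      ((Real.cosh x : ℂ) * PcDeriv ρ 1 (Real.cosh x) + (Real.sinh x : ℂ) ^ 2 * PcDeriv ρ 2 (Real.cosh x)) x) ∧
    (∀ x, HasDerivAt (fun x => (Real.cosh x : ℂ) * PcDeriv ρ 1 (Real.cosh x) + (Real.sinh x : ℂ) ^ 2 * PcDeriv ρ 2 (Real.cosh x))
      ((Real.sinh x : ℂ) * PcDeriv ρ 1 (Real.cosh x) + 3 * (Real.sinh x : ℂ) * Real.cosh x * PcDeriv ρ 2 (Real.cosh x) +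
        (Real.sinh x : ℂ) ^ 3 * PcDeriv ρ 3 (Real.cosh x)) x) := by
  have hcomp : ∀ k x, HasDerivAt (fun x => PcDeriv ρ k (Real.cosh x)) ((Real.sinh x : ℂ) * PcDeriv ρ (k + 1) (Real.cosh x)) x := by
    intro k x
    have h1 := (h.hasDerivAt_PcDeriv k (Real.cosh x)).scomp x (Real.hasDerivAt_cosh x)
    have e : Real.sinh x • PcDeriv ρ (k + 1) (Real.cosh x) = (Real.sinh x : ℂ) * PcDeriv ρ (k + 1) (Real.cosh x) := Complex.real_smul
    rw [e] at h1
    exact h1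
  have hch : ∀ x, HasDerivAt (fun x => (Real.cosh x : ℂ)) (Real.sinh x : ℂ) x := fun x => (Real.hasDerivAt_cosh x).ofReal_comp
  have hsh : ∀ x, HasDerivAt (fun x => (Real.sinh x : ℂ)) (Real.cosh x : ℂ) x := fun x => (Real.hasDerivAt_sinh x).ofReal_comp
  refine ⟨hcomp 0, fun x => ?_, fun x => ?_⟩
  · have := (hsh x).mul (hcomp 1 x)
    refine this.congr_deriv ?_
    ring
  · have := ((hch x).mul (hcomp 1 x)).add (((hsh x).pow 2).mul (hcomp 2 x))
    refine this.congr_deriv ?_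
    simp only [Pi.pow_apply]
    push_cast; ring

/-- A weighted monomial `e^{σx} cosh^p sinh^q G_k(cosh x)` is integrable (`|σ| ≤ A`). [folklore] -/
theorem integrable_exp_term_cosh {σ : ℝ} {A : ℕ} (hσ : |σ| ≤ A) (k p q : ℕ) :
    Integrable fun x : ℝ => (Real.exp (σ * x) : ℂ) * ((Real.cosh x : ℂ) ^ p * (Real.sinh x : ℂ) ^ q * PcDeriv ρ k (Real.cosh x)) := by
  obtain ⟨C, hC0, hC⟩ := h.norm_PcDeriv_cosh_le k (A + p + q + 2)
  refine integrable_of_le_div_one_add_abs_sinh_sq (C := 2 ^ A * C) ?_ fun x => ?_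
  · exact (by fun_prop : Continuous fun x : ℝ => (Real.exp (σ * x) : ℂ)).mul
      ((by fun_prop : Continuous fun x : ℝ => (Real.cosh x : ℂ) ^ p * (Real.sinh x : ℂ) ^ q).mul
        ((h.continuous_PcDeriv k).comp Real.continuous_cosh))
  · rw [norm_mul, norm_mul, norm_mul, norm_pow, norm_pow, Complex.norm_real, Complex.norm_real, Complex.norm_real,
      Real.norm_eq_abs, Real.norm_eq_abs, Real.norm_eq_abs, abs_of_pos (Real.exp_pos _), abs_of_pos (Real.cosh_pos x)]
    have hs : 0 ≤ |Real.sinh x| := abs_nonneg _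
    have hc : Real.cosh x ≤ 1 + |Real.sinh x| := by linarith [IsTest.cosh_le_abs_sinh_add_one x]
    have h1 : Real.cosh x ^ p ≤ (1 + |Real.sinh x|) ^ p := pow_le_pow_left₀ (Real.cosh_pos x).le hc p
    have h2 : |Real.sinh x| ^ q ≤ (1 + |Real.sinh x|) ^ q := pow_le_pow_left₀ hs (by linarith) q
    have h3 := hC x
    have h4 : Real.exp (σ * x) ≤ (2 : ℝ) ^ A * (1 + |Real.sinh x|) ^ A := by
      refine le_trans ?_ (exp_nat_mul_abs_le A x)
      rw [Real.exp_le_exp]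
      calc σ * x ≤ |σ * x| := le_abs_self _
        _ = |σ| * |x| := abs_mul _ _
        _ ≤ A * |x| := mul_le_mul_of_nonneg_right hσ (abs_nonneg x)
    have hpos : 0 < (1 + |Real.sinh x|) := by positivity
    calc Real.exp (σ * x) * (Real.cosh x ^ p * |Real.sinh x| ^ q * ‖PcDeriv ρ k (Real.cosh x)‖)
        ≤ ((2 : ℝ) ^ A * (1 + |Real.sinh x|) ^ A) *
            ((1 + |Real.sinh x|) ^ p * (1 + |Real.sinh x|) ^ q * (C / (1 + |Real.sinh x|) ^ (A + p + q + 2))) := by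
          gcongr
      _ = 2 ^ A * C / (1 + |Real.sinh x|) ^ 2 := by
          rw [pow_add, pow_add, pow_add]; field_simp

/-- `g_σ = e^{σx} G₀(cosh x)`: `|w|^m ‖𝓐g_σ(w)‖ ≤ ‖g_σ^{(m)}‖₁` for `m ≤ 3` (`|σ| ≤ A`). [folklore] -/
theorem pow_mul_norm_four_exp_mul_cosh_le {σ : ℝ} {A : ℕ} (hσ : |σ| ≤ A) {m : ℕ} (hm : m ≤ 3) (w : ℝ) :
    |w| ^ m * ‖four (fun x => (Real.exp (σ * x) : ℂ) * PcDeriv ρ 0 (Real.cosh x)) w‖ ≤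
      ∫ x, ‖iteratedDeriv m (fun x => (Real.exp (σ * x) : ℂ) * PcDeriv ρ 0 (Real.cosh x)) x‖ := by
  obtain ⟨c0, c1, c2⟩ := h.hasDerivAt_chain_cosh
  obtain ⟨e1, e2, e3⟩ := iteratedDeriv_exp_mul_formulas σ c0 c1 c2
  have hcd : ContDiff ℝ 3 fun x => (Real.exp (σ * x) : ℂ) * PcDeriv ρ 0 (Real.cosh x) := by
    have h1 : ContDiff ℝ 3 fun x : ℝ => (Real.exp (σ * x) : ℂ) :=
      Complex.ofRealCLM.contDiff.comp ((Real.contDiff_exp.comp (contDiff_const.mul contDiff_id)).of_le le_top)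
    exact h1.mul (((h.contDiff_PcDeriv 0).comp Real.contDiff_cosh).of_le (WithTop.coe_le_coe.mpr le_top))
  refine pow_mul_norm_four_le' hcd (fun n hn => ?_) hm w
  have t000 := h.integrable_exp_term_cosh hσ 0 0 0
  have t101 := h.integrable_exp_term_cosh hσ 1 0 1
  have t110 := h.integrable_exp_term_cosh hσ 1 1 0
  have t202 := h.integrable_exp_term_cosh hσ 2 0 2
  have t211 := h.integrable_exp_term_cosh hσ 2 1 1
  have t303 := h.integrable_exp_term_cosh hσ 3 0 3
  interval_cases n
  · simpa using t000
  · rw [e1]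
    refine ((t000.const_mul (σ : ℂ)).add t101).congr (ae_of_all _ fun x => ?_)
    simp only [pow_zero, pow_one, one_mul, Pi.add_apply]; ring
  · rw [e2]
    refine ((((t000.const_mul ((σ : ℂ) ^ 2)).add (t101.const_mul (2 * (σ : ℂ)))).add t110).add t202).congr
      (ae_of_all _ fun x => ?_)
    simp only [pow_zero, pow_one, one_mul, mul_one, Pi.add_apply]; ring
  · rw [e3]
    refine (((((((t000.const_mul ((σ : ℂ) ^ 3)).add (t101.const_mul (3 * (σ : ℂ) ^ 2))).add (t110.const_mul (3 * (σ : ℂ)))).add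
      (t202.const_mul (3 * (σ : ℂ)))).add t101).add (t211.const_mul 3)).add t303).congr (ae_of_all _ fun x => ?_)
    simp only [pow_zero, pow_one, one_mul, mul_one, Pi.add_apply]; ring

/-- The weight `(e^{Ax} + e^{-Ax}) ‖cosh^p sinh^q G_k(cosh x)‖` is integrable. [folklore] -/
theorem integrable_weight_term_cosh (A k p q : ℕ) :
    Integrable fun x : ℝ => (Real.exp (A * x) + Real.exp (-(A * x))) *
      ‖(Real.cosh x : ℂ) ^ p * (Real.sinh x : ℂ) ^ q * PcDeriv ρ k (Real.cosh x)‖ := by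
  have hA1 : |(A : ℝ)| ≤ A := by rw [abs_of_nonneg (Nat.cast_nonneg A)]
  have hA2 : |(-(A : ℝ))| ≤ A := by rw [abs_neg, abs_of_nonneg (Nat.cast_nonneg A)]
  have t1 := (h.integrable_exp_term_cosh hA1 k p q).norm
  have t2 := (h.integrable_exp_term_cosh hA2 k p q).norm
  refine (t1.add t2).congr (ae_of_all _ fun x => ?_)
  simp only [Pi.add_apply, norm_mul, Complex.norm_real, Real.norm_eq_abs, abs_of_pos (Real.exp_pos _), neg_mul]
  ring

/-- **Decay of `𝔓_ρ` in horizontal strips**: `‖𝔓_ρ(σ + iw)‖ ≤ C_A/(1+|w|)³` for `|σ| ≤ A`. [folklore] -/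
theorem norm_kPlus_le (A : ℕ) : ∃ C : ℝ, 0 ≤ C ∧ ∀ σ w : ℝ, |σ| ≤ A →
    ‖kPlus ρ ((σ : ℂ) + I * w)‖ ≤ C / (1 + |w|) ^ 3 := by
  set G0 : ℝ → ℂ := fun x => PcDeriv ρ 0 (Real.cosh x) with hG0
  set G1 : ℝ → ℂ := fun x => (Real.sinh x : ℂ) * PcDeriv ρ 1 (Real.cosh x) with hG1
  set G2 : ℝ → ℂ := fun x => (Real.cosh x : ℂ) * PcDeriv ρ 1 (Real.cosh x) + (Real.sinh x : ℂ) ^ 2 * PcDeriv ρ 2 (Real.cosh x) with hG2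
  set G3 : ℝ → ℂ := fun x => (Real.sinh x : ℂ) * PcDeriv ρ 1 (Real.cosh x) + 3 * (Real.sinh x : ℂ) * Real.cosh x * PcDeriv ρ 2 (Real.cosh x) +
    (Real.sinh x : ℂ) ^ 3 * PcDeriv ρ 3 (Real.cosh x) with hG3
  set W : ℝ → ℝ := fun x => Real.exp (A * x) + Real.exp (-(A * x)) with hW
  have hW0 : ∀ x, 0 ≤ W x := fun x => by positivity
  have hck : ∀ k, Continuous fun x : ℝ => PcDeriv ρ k (Real.cosh x) := fun k => (h.continuous_PcDeriv k).comp Real.continuous_cosh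
  have i0 : Integrable fun x => W x * ‖G0 x‖ := by
    simpa [hW, hG0] using h.integrable_weight_term_cosh A 0 0 0
  have i1 : Integrable fun x => W x * ‖G1 x‖ := by
    simpa [hW, hG1] using h.integrable_weight_term_cosh A 1 0 1
  have i2 : Integrable fun x => W x * ‖G2 x‖ := by
    have t1 := h.integrable_weight_term_cosh A 1 1 0
    have t2 := h.integrable_weight_term_cosh A 2 0 2
    refine ((t1.add t2).mono' ((by fun_prop : Continuous W).mul ?_).aestronglyMeasurable (ae_of_all _ fun x => ?_))
    · exact (((by fun_prop : Continuous fun x : ℝ => (Real.cosh x : ℂ)).mul (hck 1)).add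
        ((by fun_prop : Continuous fun x : ℝ => (Real.sinh x : ℂ) ^ 2).mul (hck 2))).norm
    · rw [Real.norm_eq_abs, abs_of_nonneg (by positivity)]
      simp only [hG2, Pi.add_apply, pow_zero, pow_one, one_mul, mul_one]
      calc W x * ‖(Real.cosh x : ℂ) * PcDeriv ρ 1 (Real.cosh x) + (Real.sinh x : ℂ) ^ 2 * PcDeriv ρ 2 (Real.cosh x)‖
          ≤ W x * (‖(Real.cosh x : ℂ) * PcDeriv ρ 1 (Real.cosh x)‖ + ‖(Real.sinh x : ℂ) ^ 2 * PcDeriv ρ 2 (Real.cosh x)‖) :=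
            mul_le_mul_of_nonneg_left (norm_add_le _ _) (hW0 x)
        _ = _ := by simp only [hW]; ring
  have i3 : Integrable fun x => W x * ‖G3 x‖ := by
    have t1 := h.integrable_weight_term_cosh A 1 0 1
    have t2 := (h.integrable_weight_term_cosh A 2 1 1).const_mul 3
    have t3 := h.integrable_weight_term_cosh A 3 0 3
    refine (((t1.add t2).add t3).mono' ((by fun_prop : Continuous W).mul ?_).aestronglyMeasurable (ae_of_all _ fun x => ?_))
    · exact ((((by fun_prop : Continuous fun x : ℝ => (Real.sinh x : ℂ)).mul (hck 1)).add
        ((by fun_prop : Continuous fun x : ℝ => 3 * (Real.sinh x : ℂ) * Real.cosh x).mul (hck 2))).add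
        ((by fun_prop : Continuous fun x : ℝ => (Real.sinh x : ℂ) ^ 3).mul (hck 3))).norm
    · rw [Real.norm_eq_abs, abs_of_nonneg (by positivity)]
      simp only [hG3, Pi.add_apply, pow_one]
      have e3 : ‖3 * (Real.sinh x : ℂ) * Real.cosh x * PcDeriv ρ 2 (Real.cosh x)‖ = 3 * ‖(Real.cosh x : ℂ) ^ 1 * (Real.sinh x : ℂ) ^ 1 * PcDeriv ρ 2 (Real.cosh x)‖ := by
        rw [pow_one, pow_one, show 3 * (Real.sinh x : ℂ) * Real.cosh x * PcDeriv ρ 2 (Real.cosh x) = 3 * ((Real.cosh x : ℂ) * Real.sinh x * PcDeriv ρ 2 (Real.cosh x)) by ring,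
          norm_mul, Complex.norm_ofNat]
      have e1 : ‖(Real.sinh x : ℂ) * PcDeriv ρ 1 (Real.cosh x)‖ = ‖(Real.cosh x : ℂ) ^ 0 * (Real.sinh x : ℂ) * PcDeriv ρ 1 (Real.cosh x)‖ := by
        rw [pow_zero, one_mul]
      have e4 : ‖(Real.sinh x : ℂ) ^ 3 * PcDeriv ρ 3 (Real.cosh x)‖ = ‖(Real.cosh x : ℂ) ^ 0 * (Real.sinh x : ℂ) ^ 3 * PcDeriv ρ 3 (Real.cosh x)‖ := by
        rw [pow_zero, one_mul]
      calc W x * ‖(Real.sinh x : ℂ) * PcDeriv ρ 1 (Real.cosh x) + 3 * (Real.sinh x : ℂ) * Real.cosh x * PcDeriv ρ 2 (Real.cosh x) +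
            (Real.sinh x : ℂ) ^ 3 * PcDeriv ρ 3 (Real.cosh x)‖
          ≤ W x * (‖(Real.sinh x : ℂ) * PcDeriv ρ 1 (Real.cosh x)‖ + ‖3 * (Real.sinh x : ℂ) * Real.cosh x * PcDeriv ρ 2 (Real.cosh x)‖ +
            ‖(Real.sinh x : ℂ) ^ 3 * PcDeriv ρ 3 (Real.cosh x)‖) :=
            mul_le_mul_of_nonneg_left ((norm_add_le _ _).trans (add_le_add (norm_add_le _ _) le_rfl)) (hW0 x)
        _ = _ := by rw [e3, e1, e4]; simp only [hW]; ring
  set N0 := ∫ x, W x * ‖G0 x‖ with hN0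
  set N1 := ∫ x, W x * ‖G1 x‖ with hN1
  set N2 := ∫ x, W x * ‖G2 x‖ with hN2
  set N3 := ∫ x, W x * ‖G3 x‖ with hN3
  have hN00 : 0 ≤ N0 := integral_nonneg fun x => by positivity
  have hN10 : 0 ≤ N1 := integral_nonneg fun x => by positivity
  have hN20 : 0 ≤ N2 := integral_nonneg fun x => by positivity
  have hN30 : 0 ≤ N3 := integral_nonneg fun x => by positivity
  set B : ℝ := (A : ℝ) ^ 3 * N0 + 3 * (A : ℝ) ^ 2 * N1 + 3 * A * N2 + N3 with hB
  have hB0 : 0 ≤ B := by positivity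
  refine ⟨2 ^ 3 * (N0 + B), by positivity, fun σ w hσ => ?_⟩
  obtain ⟨c0, c1, c2⟩ := h.hasDerivAt_chain_cosh
  obtain ⟨e1, e2, e3⟩ := iteratedDeriv_exp_mul_formulas σ c0 c1 c2
  set g : ℝ → ℂ := fun x => (Real.exp (σ * x) : ℂ) * PcDeriv ρ 0 (Real.cosh x) with hg
  have hrep : kPlus ρ ((σ : ℂ) + I * w) = four g (-w) := by
    rw [kPlus, four_neg_eq_integral]
    refine integral_congr_ae (ae_of_all _ fun x => ?_)
    simp only [hg, h.Pc_eq_PcDeriv_zero]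
    rw [add_mul, Complex.exp_add, Complex.ofReal_exp]
    push_cast; ring
  have hL0 : ∫ x, ‖iteratedDeriv 0 g x‖ ≤ N0 := by
    simpa [hg] using integral_norm_exp_mul_le hσ (F := G0) i0
  have hL3 : ∫ x, ‖iteratedDeriv 3 g x‖ ≤ B := by
    rw [e3]
    have hpt : ∀ x : ℝ, ‖(Real.exp (σ * x) : ℂ) * (σ ^ 3 * G0 x + 3 * σ ^ 2 * G1 x + 3 * σ * G2 x + G3 x)‖ ≤
        (A : ℝ) ^ 3 * (W x * ‖G0 x‖) + 3 * (A : ℝ) ^ 2 * (W x * ‖G1 x‖) + 3 * A * (W x * ‖G2 x‖) + W x * ‖G3 x‖ := by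
      intro x
      rw [norm_mul, Complex.norm_real, Real.norm_eq_abs, abs_of_pos (Real.exp_pos _)]
      have hEW := exp_le_exp_add_exp hσ x
      have hσA : |σ| ≤ (A : ℝ) := hσ
      have hin : ‖(σ : ℂ) ^ 3 * G0 x + 3 * σ ^ 2 * G1 x + 3 * σ * G2 x + G3 x‖ ≤
          (A : ℝ) ^ 3 * ‖G0 x‖ + 3 * (A : ℝ) ^ 2 * ‖G1 x‖ + 3 * A * ‖G2 x‖ + ‖G3 x‖ := by
        refine (norm_add_le _ _).trans (add_le_add ((norm_add_le _ _).trans (add_le_add ((norm_add_le _ _).trans (add_le_add ?_ ?_)) ?_)) le_rfl)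
        · rw [norm_mul, norm_pow, Complex.norm_real, Real.norm_eq_abs]; gcongr
        · rw [norm_mul, norm_mul, norm_pow, Complex.norm_real, Real.norm_eq_abs, Complex.norm_ofNat]; gcongr
        · rw [norm_mul, norm_mul, Complex.norm_real, Real.norm_eq_abs, Complex.norm_ofNat]; gcongr
      calc Real.exp (σ * x) * ‖(σ : ℂ) ^ 3 * G0 x + 3 * σ ^ 2 * G1 x + 3 * σ * G2 x + G3 x‖
          ≤ W x * ((A : ℝ) ^ 3 * ‖G0 x‖ + 3 * (A : ℝ) ^ 2 * ‖G1 x‖ + 3 * A * ‖G2 x‖ + ‖G3 x‖) :=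
            mul_le_mul hEW hin (norm_nonneg _) (hW0 x)
        _ = _ := by ring
    have hI01 : Integrable fun x => (A : ℝ) ^ 3 * (W x * ‖G0 x‖) + 3 * (A : ℝ) ^ 2 * (W x * ‖G1 x‖) :=
      (i0.const_mul _).add (i1.const_mul _)
    have hI012 : Integrable fun x => (A : ℝ) ^ 3 * (W x * ‖G0 x‖) + 3 * (A : ℝ) ^ 2 * (W x * ‖G1 x‖) + 3 * A * (W x * ‖G2 x‖) :=
      hI01.add (i2.const_mul _)
    have hint : Integrable fun x => (A : ℝ) ^ 3 * (W x * ‖G0 x‖) + 3 * (A : ℝ) ^ 2 * (W x * ‖G1 x‖) + 3 * A * (W x * ‖G2 x‖) + W x * ‖G3 x‖ :=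
      hI012.add i3
    calc (∫ x, ‖(Real.exp (σ * x) : ℂ) * (σ ^ 3 * G0 x + 3 * σ ^ 2 * G1 x + 3 * σ * G2 x + G3 x)‖)
        ≤ ∫ x, ((A : ℝ) ^ 3 * (W x * ‖G0 x‖) + 3 * (A : ℝ) ^ 2 * (W x * ‖G1 x‖) + 3 * A * (W x * ‖G2 x‖) + W x * ‖G3 x‖) :=
          integral_mono_of_nonneg (ae_of_all _ fun x => norm_nonneg _) hint (ae_of_all _ hpt)
      _ = B := by
          rw [integral_add hI012 i3, integral_add hI01 (i2.const_mul _), integral_add (i0.const_mul _) (i1.const_mul _),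
            integral_const_mul, integral_const_mul, integral_const_mul]
  have hbd := norm_le_div_one_add_abs_pow (G := fun w => four g (-w)) (A := N0) (B := B) (m := 3)
    (fun w => by
      have := h.pow_mul_norm_four_exp_mul_cosh_le hσ (m := 0) (by norm_num) (-w)
      rw [pow_zero, one_mul] at this
      exact this.trans hL0)
    (fun w => by
      have := h.pow_mul_norm_four_exp_mul_cosh_le hσ (m := 3) le_rfl (-w)
      rw [abs_neg] at this
      exact this.trans hL3) w
  rw [hrep]
  exact hbd

/-- `4∫ cos(2tξ) P_ρ(cosh ξ) dξ = 4 𝔓_ρ(2it)` (real `t`). [folklore] -/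
theorem four_mul_integral_cos_mul_Pc_cosh (t : ℝ) :
    4 * ∫ ξ : ℝ, (Real.cos (2 * t * ξ) : ℂ) * Pc ρ (Real.cosh ξ) = 4 * kPlus ρ (2 * I * t) := by
  have i1 := h.integrable_kPlus_integrand (2 * I * t)
  have i2 := h.integrable_kPlus_integrand (-(2 * I * t))
  have e : (∫ ξ : ℝ, (Real.cos (2 * t * ξ) : ℂ) * Pc ρ (Real.cosh ξ)) = (kPlus ρ (2 * I * t) + kPlus ρ (-(2 * I * t))) / 2 := by
    rw [kPlus, kPlus, ← integral_add i1 i2, ← integral_div]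
    refine integral_congr_ae (ae_of_all _ fun ξ => ?_)
    dsimp only
    rw [Complex.ofReal_cos, Complex.cos]
    push_cast; ring_nf
  rw [e, kPlus_neg]; ring

/-- `4∫ cosh(2yξ) P_ρ(cosh ξ) dξ = 4 𝔓_ρ(2y)` (real `y`). [folklore] -/
theorem four_mul_integral_cosh_mul_Pc_cosh (y : ℝ) :
    4 * ∫ ξ : ℝ, (Real.cosh (2 * y * ξ) : ℂ) * Pc ρ (Real.cosh ξ) = 4 * kPlus ρ (2 * y) := by
  have i1 := h.integrable_kPlus_integrand (2 * y)
  have i2 := h.integrable_kPlus_integrand (-(2 * y))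
  have e : (∫ ξ : ℝ, (Real.cosh (2 * y * ξ) : ℂ) * Pc ρ (Real.cosh ξ)) = (kPlus ρ (2 * y) + kPlus ρ (-(2 * y))) / 2 := by
    rw [kPlus, kPlus, ← integral_add i1 i2, ← integral_div]
    refine integral_congr_ae (ae_of_all _ fun ξ => ?_)
    dsimp only
    rw [Complex.ofReal_cosh, Complex.cosh]
    push_cast; ring_nf
  rw [e, kPlus_neg]; ring

end IsSmoothPosTest

open Literature.NumberTheory.Sieve.BFI.L1 in
/-- **The plus transform is one entire function of the spectral parameter.** For `f` smooth with compact
support in `(0, ∞)` there is an entire, even `H : ℂ → ℂ` with `H(t) = f̃(t) = kuzTransforms.Tpl f t` for real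
`t`, `H(iy) = kuzTransforms.TplX f y` for real `y`, and `‖H(t)‖ ≤ C_A (1 + |Re t|)^{-3}` for `|Im t| ≤ A`
(the hypotheses (1.63) for `h = f̃`, i.e. for `T_f` of (9.18)). For real `t ≠ 0`,
`H(t) = (2πi/sinh πt)∫₀^∞ (J_{2it} - J_{-2it})(x) f(x) dx/x` by `kuzTransforms_Tpl_eq_besselJ`.
[cite: Iwaniec2002, (1.63), (9.17)–(9.18); DeshouillersIwaniec1982, Lemma 7.1] -/
theorem kuzTransforms_Tpl_entire {f : ℝ → ℂ} (hf : ContDiff ℝ ∞ f) (hc : HasCompactSupport f) (hs : tsupport f ⊆ Set.Ioi 0) :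
    ∃ H : ℂ → ℂ, Differentiable ℂ H ∧ (∀ t : ℂ, H (-t) = H t) ∧
      (∀ t : ℝ, H t = kuzTransforms.Tpl f t) ∧ (∀ y : ℝ, H (I * y) = kuzTransforms.TplX f y) ∧
      ∀ A : ℕ, ∃ C : ℝ, 0 ≤ C ∧ ∀ t : ℂ, |t.im| ≤ A → ‖H t‖ ≤ C / (1 + |t.re|) ^ 3 := by
  obtain ⟨a, b, hρ⟩ := isSmoothPosTest_div hf hc hs
  set ρ : ℝ → ℂ := fun x => f x / (x : ℂ) with hρdef
  refine ⟨fun t => 4 * kPlus ρ (2 * I * t), ?_, ?_, ?_, ?_, ?_⟩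
  · exact (hρ.differentiable_kPlus.comp ((differentiable_const _).mul differentiable_id)).const_mul _
  · intro t
    show 4 * kPlus ρ (2 * I * -t) = 4 * kPlus ρ (2 * I * t)
    rw [show 2 * I * -t = -(2 * I * t) by ring, IsSmoothPosTest.kPlus_neg]
  · intro t
    show 4 * kPlus ρ (2 * I * t) = 4 * ∫ ξ : ℝ, (Real.cos (2 * t * ξ) : ℂ) * Kuz.IsTest.Hp f ξ
    rw [← hρ.four_mul_integral_cos_mul_Pc_cosh t]
    congr 1
    refine integral_congr_ae (ae_of_all _ fun ξ => ?_)
    dsimp only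
    rw [Kuz.IsTest.Hp, Pk_zero_eq_Pc hf.continuous hc hs]
  · intro y
    show 4 * kPlus ρ (2 * I * (I * y)) = 4 * ∫ ξ : ℝ, (Real.cosh (2 * y * ξ) : ℂ) * Kuz.IsTest.Hp f ξ
    rw [show 2 * I * (I * (y : ℂ)) = -(2 * y) by ring_nf; rw [Complex.I_sq]; ring, IsSmoothPosTest.kPlus_neg,
      ← hρ.four_mul_integral_cosh_mul_Pc_cosh y]
    congr 1
    refine integral_congr_ae (ae_of_all _ fun ξ => ?_)
    dsimp only
    rw [Kuz.IsTest.Hp, Pk_zero_eq_Pc hf.continuous hc hs]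
  · intro A
    obtain ⟨C, hC0, hC⟩ := hρ.norm_kPlus_le (2 * A)
    refine ⟨4 * C, by positivity, fun t ht => ?_⟩
    show ‖4 * kPlus ρ (2 * I * t)‖ ≤ _
    have e : 2 * I * t = ((-2 * t.im : ℝ) : ℂ) + I * ((2 * t.re : ℝ) : ℂ) := by
      apply Complex.ext <;> simp
    have hσ : |(-2 * t.im)| ≤ ((2 * A : ℕ) : ℝ) := by
      rw [abs_mul, abs_neg, abs_two]; push_cast; linarith
    have := hC (-2 * t.im) (2 * t.re) hσ
    rw [e, norm_mul, Complex.norm_ofNat]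
    have hpos : 0 < (1 + |t.re|) ^ 3 := by positivity
    calc 4 * ‖kPlus ρ (((-2 * t.im : ℝ) : ℂ) + I * ((2 * t.re : ℝ) : ℂ))‖ ≤ 4 * (C / (1 + |2 * t.re|) ^ 3) := by gcongr
      _ ≤ 4 * (C / (1 + |t.re|) ^ 3) := by
          apply mul_le_mul_of_nonneg_left _ (by norm_num)
          apply div_le_div_of_nonneg_left hC0 hpos
          apply pow_le_pow_left₀ (by positivity)
          rw [abs_mul, abs_two]; linarith [abs_nonneg t.re]
      _ = 4 * C / (1 + |t.re|) ^ 3 := by ring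

end Literature.Analysis.FunctionSpaces
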